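import Summits.AtomisticToContinuum.FouriersLaw.Theses.BondHeatUncertainty
import Summits.AtomisticToContinuum.FouriersLaw.Theorems.BondHeatUncertaintySubdiffusiveBondHeatBathBondReductionVariance
import Summits.AtomisticToContinuum.FouriersLaw.Theorems.BondHeatUncertaintySubdiffusiveBondHeatBathBondReductionCorrelations
import Summits.AtomisticToContinuum.FouriersLaw.Theorems.BondHeatUncertaintySubdiffusiveBondHeatBathBondReductionDynkin
import Summits.AtomisticToContinuum.FouriersLaw.Theorems.BondHeatUncertaintySubdiffusiveBondHeatKernelGibbsD

/-!
# `SubdiffusiveBondHeat` / bath-bond reduction, part 7: the reduction, conditional on three kernel/Gibbs facts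

Helper file for crux `stmt-AtomisticToContinuum-9120` (`BondHeatUncertainty.SubdiffusiveBondHeat`), line
`bath-bond-deficit-integral`, stub `stub_bathBondReduction` (fixed `N ≥ 2`, every `t ≥ 0`:
`V_N(0,t) ≤ 4γT² ∫₀ᵗ (1 - θ_N(s)) ds + 8 E_{μ_T}[e₀²]`, with `V_N(0,t) = 2∫₀ᵗ (t-s) C_N(0,s) ds`,
`C_N(0,s) = ∫ j₀ · (P_s j₀) dμ_T`, `θ_N(s) = (γ/T²)∫₀ˢ K_N`, `K_N(u) = ∫ (p₀² - T) · P_u(p₀² - T) dμ_T`,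
`e₀ = p₀²/2 + U(q₀) + ½V(q₁ - q₀)`). This file proves the stub's conclusion VERBATIM at every fixed parameter point,
using the kernel Gibbs invariance (H1) `μ_T.bind P_s = μ_T` (`BoundaryEscapeDeficit.BoundaryKernelBasics` (a),
stmt-AtomisticToContinuum-12239, PROVED: `pinnedChain_gibbsMeasure_bind_transitionKernel`, `…KernelGibbsD.lean`) and
CONDITIONAL on three explicit hypotheses about the constructed kernels `P_t = OscillatorChain.transitionKernel` and
the Gibbs measure `μ_T = OscillatorChain.gibbsMeasure` (none of which is proved in the tree today):

* (H2) DETAILED BALANCE under momentum reversal `Θ(q,p) = (q,-p)`, weak `L²` form: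
  `∫ f · (P_s h) dμ_T = ∫ (h∘Θ) · P_s (f∘Θ) dμ_T` for `f, h` measurable with `f², h² ∈ L¹(μ_T)` — the
  generalised detailed balance `L† = ΘLΘ` of the equilibrium Langevin dynamics at the kernel level; no item; the
  tree has the Lebesgue duality with the anti-friction reversal (`compProd_langevinKernel_eq`) for confining chains,
  from which (H2) is a Doob `e^{-H/T}`-transform away.
* (H3) DYNKIN'S IDENTITY for the polynomially growing observable `e₀`: `P_r e₀(z) - e₀(z) = ∫₀ʳ P_s(Le₀)(z) ds` with
  `Le₀ = -j₀ + γ(T - p₀²)` (part 1, `pinnedChain_generator_siteEnergy`); the tree has Dynkin for `C_c^∞` only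
  (`pinnedChain_dynkin`); the extension is a truncation argument with the exponential moment bounds along the flow.
* (H4) the STATIC Gibbs inequality `∫ e₀ (j₀ - γ(T - p₀²)) dμ_T ≤ γT²` (true with equality from `⟨j₀ e₀⟩ = 0`,
  `⟨p₀²⟩ = T`, `⟨p₀⁴⟩ = 3T²`, `p₀ ⊥ q`; cf. the neighbour stub `stub_gibbsMomentumFourthMoment`).

The proof is the Kundu–Dhar–Narayan bath-heat argument run ENTIRELY AT THE KERNEL LEVEL (no stochastic
integration): with `X = ∫₀ᵗ j₀(z_s) ds`, `D = ∫₀ᵗ γ(T - p₀²)(z_s) ds`, `Δ = e₀(z_t) - e₀(z_0)` along the stationary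
constructed flow (parts 3–5: `V_N = E X²`, all second moments as kernel pairings), `E[XD] = 0` and
`E[Δ D] = 0` by (H2), the Dynkin martingale `M = Δ + X - D` has `E M² = -2t⟨Le₀, e₀⟩ ≤ 2γT²t` by (H3)+(H4) (parts
5–6: end-point correlations, integrated Dynkin, triangle identity), and the two positivity statements
`E[(X + 2Δ)²] ≥ 0`, `E[(e₀(z_t) + e₀(z_0))²] ≥ 0` close the estimate:
`E X² ≤ 2(E M² - E D²) + 2E Δ² ≤ 4γT²t - 2E D² + 8‖e₀‖² = 4γT²∫₀ᵗ(1 - θ_N) + 8‖e₀‖²`.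

* `bathBondReduction_conditional` — the conditional reduction at fixed parameters;
* `stub_bathBondReduction_of_kernelFacts` — its closed form (registered sub-goal).

Nothing here closes an item; `stub_bathBondReduction` itself stays open (blocked on (H2)–(H3); (H4) is statics).
-/

noncomputable section

open MeasureTheory ProbabilityTheory Filter Topology Set intervalIntegral
open scoped NNReal ENNReal
open Literature.MathematicalPhysics.KineticTheory.HeatConduction Literature.Probability.Process

namespace Summit.AtomisticToContinuum.FouriersLaw.Theorems.SubdiffusiveBondHeat

open OscillatorChain

/-- **The bath-bond reduction at fixed parameters, conditional on (H2)–(H4)** (see the module docstring):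
for the pinned chain (`ω₂, lam, β, γ > 0`), `T > 0`, `N ≥ 2`, detailed balance (H2), Dynkin for `e₀` (H3) and
the static inequality (H4) imply (with the proved invariance (H1)), for every `t ≥ 0`,
`2∫₀ᵗ (t-s) ⟨j₀, P_s j₀⟩ ds ≤ 4γT² ∫₀ᵗ (1 - (γ/T²)∫₀ˢ ⟨p₀²-T, P_u(p₀²-T)⟩ du) ds + 8 ∫ e₀² dμ_T`.
[folklore] -/
theorem bathBondReduction_conditional (ω₂ lam β γ : ℝ) (hω : 0 < ω₂) (hl : 0 < lam) (hβ : 0 < β) (hγ : 0 < γ)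
    (T : ℝ) (hT : 0 < T) (N : ℕ) (hN : 1 < N)
    (hdb : ∀ (s : ℝ≥0) (f h : PhaseSpace N → ℝ), Measurable f → Measurable h →
      Integrable (fun y => f y ^ 2) ((pinnedChain ω₂ lam β γ).gibbsMeasure N T) → Integrable (fun y => h y ^ 2) ((pinnedChain ω₂ lam β γ).gibbsMeasure N T) →
      ∫ y, f y * (∫ y', h y' ∂((pinnedChain ω₂ lam β γ).transitionKernel N T T s) y) ∂((pinnedChain ω₂ lam β γ).gibbsMeasure N T) =
        ∫ y, h (y.1, -y.2) * (∫ y', f (y'.1, -y'.2) ∂((pinnedChain ω₂ lam β γ).transitionKernel N T T s) y) ∂((pinnedChain ω₂ lam β γ).gibbsMeasure N T))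
    (hdyn : ∀ (r : ℝ≥0) (z : PhaseSpace N),
      ∫ y, ((y.2 ⟨0, Nat.zero_lt_of_lt hN⟩) ^ 2 / 2 + (pinnedChain ω₂ lam β γ).U (y.1 ⟨0, Nat.zero_lt_of_lt hN⟩) + (pinnedChain ω₂ lam β γ).V (y.1 ⟨1, hN⟩ - y.1 ⟨0, Nat.zero_lt_of_lt hN⟩) / 2) ∂((pinnedChain ω₂ lam β γ).transitionKernel N T T r z) - ((z.2 ⟨0, Nat.zero_lt_of_lt hN⟩) ^ 2 / 2 + (pinnedChain ω₂ lam β γ).U (z.1 ⟨0, Nat.zero_lt_of_lt hN⟩) + (pinnedChain ω₂ lam β γ).V (z.1 ⟨1, hN⟩ - z.1 ⟨0, Nat.zero_lt_of_lt hN⟩) / 2) =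
        ∫ s in (0 : ℝ)..(r : ℝ), ∫ y, (γ * (T - (y.2 ⟨0, Nat.zero_lt_of_lt hN⟩) ^ 2) - (pinnedChain ω₂ lam β γ).bondCurrent N ⟨0, Nat.zero_lt_of_lt hN⟩ y) ∂((pinnedChain ω₂ lam β γ).transitionKernel N T T s.toNNReal z))
    (hstat : ∫ y, ((y.2 ⟨0, Nat.zero_lt_of_lt hN⟩) ^ 2 / 2 + (pinnedChain ω₂ lam β γ).U (y.1 ⟨0, Nat.zero_lt_of_lt hN⟩) + (pinnedChain ω₂ lam β γ).V (y.1 ⟨1, hN⟩ - y.1 ⟨0, Nat.zero_lt_of_lt hN⟩) / 2) * ((pinnedChain ω₂ lam β γ).bondCurrent N ⟨0, Nat.zero_lt_of_lt hN⟩ y - γ * (T - (y.2 ⟨0, Nat.zero_lt_of_lt hN⟩) ^ 2)) ∂((pinnedChain ω₂ lam β γ).gibbsMeasure N T) ≤ γ * T ^ 2)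
    (t : ℝ) (ht : 0 ≤ t) :
    2 * (∫ s in (0 : ℝ)..t, (t - s) *
        ∫ z, (pinnedChain ω₂ lam β γ).bondCurrent N ⟨0, Nat.zero_lt_of_lt hN⟩ z *
            (∫ y, (pinnedChain ω₂ lam β γ).bondCurrent N ⟨0, Nat.zero_lt_of_lt hN⟩ y ∂((pinnedChain ω₂ lam β γ).transitionKernel N T T s.toNNReal z))
          ∂((pinnedChain ω₂ lam β γ).gibbsMeasure N T)) ≤
      4 * γ * T ^ 2 * (∫ s in (0 : ℝ)..t, (1 - γ / T ^ 2 * ∫ u in (0 : ℝ)..s,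
          ∫ z, ((z.2 ⟨0, Nat.zero_lt_of_lt hN⟩) ^ 2 - T) *
              (∫ y, ((y.2 ⟨0, Nat.zero_lt_of_lt hN⟩) ^ 2 - T) ∂((pinnedChain ω₂ lam β γ).transitionKernel N T T u.toNNReal z))
            ∂((pinnedChain ω₂ lam β γ).gibbsMeasure N T))) +
        8 * ∫ z, ((z.2 ⟨0, Nat.zero_lt_of_lt hN⟩) ^ 2 / 2 + (pinnedChain ω₂ lam β γ).U (z.1 ⟨0, Nat.zero_lt_of_lt hN⟩) +
            (pinnedChain ω₂ lam β γ).V (z.1 ⟨1, hN⟩ - z.1 ⟨0, Nat.zero_lt_of_lt hN⟩) / 2) ^ 2 ∂((pinnedChain ω₂ lam β γ).gibbsMeasure N T) := by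
  -- (H1) kernel Gibbs invariance: PROVED (`…KernelGibbsD.lean`, BoundaryKernelBasics (a))
  have hinv : ∀ s : ℝ≥0, ((pinnedChain ω₂ lam β γ).gibbsMeasure N T).bind ((pinnedChain ω₂ lam β γ).transitionKernel N T T s) = (pinnedChain ω₂ lam β γ).gibbsMeasure N T := fun s =>
    pinnedChain_gibbsMeasure_bind_transitionKernel hω hl.le hβ.le hγ.le (Nat.zero_lt_of_lt hN) hT s
  haveI : IsProbabilityMeasure ((pinnedChain ω₂ lam β γ).gibbsMeasure N T) :=
    pinnedChain_isProbabilityMeasure_gibbsMeasure hω hl.le hβ.le γ N hT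
  haveI : ∀ u, IsMarkovKernel ((pinnedChain ω₂ lam β γ).transitionKernel N T T u) := fun u =>
    pinnedChain_isMarkovKernel_transitionKernel hω hl.le hβ.le hγ.le N T T u
  -- measurability of the observables
  have hUc : Continuous (pinnedChain ω₂ lam β γ).U := (pinnedChain_contDiff_U ω₂ lam β γ (n := 0)).continuous
  have hVc : Continuous (pinnedChain ω₂ lam β γ).V := (pinnedChain_contDiff_V ω₂ lam β γ (n := 0)).continuous
  have hJm : Measurable ((pinnedChain ω₂ lam β γ).bondCurrent N ⟨0, Nat.zero_lt_of_lt hN⟩) := (pinnedChain_continuous_bondCurrent ω₂ lam β γ N ⟨0, Nat.zero_lt_of_lt hN⟩).measurable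
  have hp0 : Continuous fun y : PhaseSpace N => y.2 ⟨0, Nat.zero_lt_of_lt hN⟩ := by fun_prop
  have hq0 : Continuous fun y : PhaseSpace N => y.1 ⟨0, Nat.zero_lt_of_lt hN⟩ := by fun_prop
  have hq1 : Continuous fun y : PhaseSpace N => y.1 ⟨1, hN⟩ := by fun_prop
  have hGc : Continuous (fun y : PhaseSpace N => γ * (T - (y.2 ⟨0, Nat.zero_lt_of_lt hN⟩) ^ 2)) := continuous_const.mul (continuous_const.sub (hp0.pow 2))
  have hGm : Measurable (fun y : PhaseSpace N => γ * (T - (y.2 ⟨0, Nat.zero_lt_of_lt hN⟩) ^ 2)) := hGc.measurable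
  have hEc : Continuous (fun y : PhaseSpace N => (y.2 ⟨0, Nat.zero_lt_of_lt hN⟩) ^ 2 / 2 + (pinnedChain ω₂ lam β γ).U (y.1 ⟨0, Nat.zero_lt_of_lt hN⟩) + (pinnedChain ω₂ lam β γ).V (y.1 ⟨1, hN⟩ - y.1 ⟨0, Nat.zero_lt_of_lt hN⟩) / 2) :=
    (((hp0.pow 2).div_const 2).add (hUc.comp hq0)).add ((hVc.comp (hq1.sub hq0)).div_const 2)
  have hEm : Measurable (fun y : PhaseSpace N => (y.2 ⟨0, Nat.zero_lt_of_lt hN⟩) ^ 2 / 2 + (pinnedChain ω₂ lam β γ).U (y.1 ⟨0, Nat.zero_lt_of_lt hN⟩) + (pinnedChain ω₂ lam β γ).V (y.1 ⟨1, hN⟩ - y.1 ⟨0, Nat.zero_lt_of_lt hN⟩) / 2) := hEc.measurable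
  have hLc : Continuous (fun y : PhaseSpace N => γ * (T - (y.2 ⟨0, Nat.zero_lt_of_lt hN⟩) ^ 2) - (pinnedChain ω₂ lam β γ).bondCurrent N ⟨0, Nat.zero_lt_of_lt hN⟩ y) := hGc.sub (pinnedChain_continuous_bondCurrent ω₂ lam β γ N ⟨0, Nat.zero_lt_of_lt hN⟩)
  have hLm : Measurable (fun y : PhaseSpace N => γ * (T - (y.2 ⟨0, Nat.zero_lt_of_lt hN⟩) ^ 2) - (pinnedChain ω₂ lam β γ).bondCurrent N ⟨0, Nat.zero_lt_of_lt hN⟩ y) := hLc.measurable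
  have hKc : Continuous (fun y : PhaseSpace N => (y.2 ⟨0, Nat.zero_lt_of_lt hN⟩) ^ 2 - T) := (hp0.pow 2).sub continuous_const
  have hKm : Measurable (fun y : PhaseSpace N => (y.2 ⟨0, Nat.zero_lt_of_lt hN⟩) ^ 2 - T) := hKc.measurable
  -- square-integrability under the Gibbs measure
  have hJ2 : Integrable (fun y => (pinnedChain ω₂ lam β γ).bondCurrent N ⟨0, Nat.zero_lt_of_lt hN⟩ y ^ 2) ((pinnedChain ω₂ lam β γ).gibbsMeasure N T) :=
    pinnedChain_integrable_sq_bondCurrent hω hl.le hβ.le γ N hT ⟨0, Nat.zero_lt_of_lt hN⟩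
  have hG2 : Integrable (fun y : PhaseSpace N => (γ * (T - (y.2 ⟨0, Nat.zero_lt_of_lt hN⟩) ^ 2)) ^ 2) ((pinnedChain ω₂ lam β γ).gibbsMeasure N T) :=
    pinnedChain_integrable_sq_kineticDeviation hω hl.le hβ.le γ N hT γ T ⟨0, Nat.zero_lt_of_lt hN⟩
  have hE2 : Integrable (fun y : PhaseSpace N => ((y.2 ⟨0, Nat.zero_lt_of_lt hN⟩) ^ 2 / 2 + (pinnedChain ω₂ lam β γ).U (y.1 ⟨0, Nat.zero_lt_of_lt hN⟩) + (pinnedChain ω₂ lam β γ).V (y.1 ⟨1, hN⟩ - y.1 ⟨0, Nat.zero_lt_of_lt hN⟩) / 2) ^ 2) ((pinnedChain ω₂ lam β γ).gibbsMeasure N T) :=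
    pinnedChain_integrable_sq_siteEnergy hω hl.le hβ.le γ N hT hN
  have hK2 : Integrable (fun y : PhaseSpace N => ((y.2 ⟨0, Nat.zero_lt_of_lt hN⟩) ^ 2 - T) ^ 2) ((pinnedChain ω₂ lam β γ).gibbsMeasure N T) := by
    have h := pinnedChain_integrable_sq_kineticDeviation hω hl.le hβ.le γ N hT (-1) T ⟨0, Nat.zero_lt_of_lt hN⟩
    refine h.congr (Eventually.of_forall fun y => ?_)
    simp only
    ring
  have hL2 : Integrable (fun y : PhaseSpace N => (γ * (T - (y.2 ⟨0, Nat.zero_lt_of_lt hN⟩) ^ 2) - (pinnedChain ω₂ lam β γ).bondCurrent N ⟨0, Nat.zero_lt_of_lt hN⟩ y) ^ 2) ((pinnedChain ω₂ lam β γ).gibbsMeasure N T) := by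
    refine ((hG2.const_mul 2).add (hJ2.const_mul 2)).mono' (hLm.pow_const 2).aestronglyMeasurable
      (Eventually.of_forall fun y => ?_)
    rw [Real.norm_eq_abs, abs_of_nonneg (sq_nonneg _)]
    simp only [Pi.add_apply]
    nlinarith [sq_nonneg (γ * (T - (y.2 ⟨0, Nat.zero_lt_of_lt hN⟩) ^ 2) + (pinnedChain ω₂ lam β γ).bondCurrent N ⟨0, Nat.zero_lt_of_lt hN⟩ y)]
  -- path-space second moments (part 4b) and end-point correlations (part 5)
  have f1 := pinnedChain_integral_intervalIntegral_mul_of_invariant hω hl.le hβ.le hγ.le N T T ((pinnedChain ω₂ lam β γ).gibbsMeasure N T) hinv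
    (f := ((pinnedChain ω₂ lam β γ).bondCurrent N ⟨0, Nat.zero_lt_of_lt hN⟩)) (h := ((pinnedChain ω₂ lam β γ).bondCurrent N ⟨0, Nat.zero_lt_of_lt hN⟩)) hJm hJm hJ2 hJ2 ht
  have f2 := pinnedChain_integral_intervalIntegral_mul_of_invariant hω hl.le hβ.le hγ.le N T T ((pinnedChain ω₂ lam β γ).gibbsMeasure N T) hinv
    (f := (fun y : PhaseSpace N => γ * (T - (y.2 ⟨0, Nat.zero_lt_of_lt hN⟩) ^ 2))) (h := (fun y : PhaseSpace N => γ * (T - (y.2 ⟨0, Nat.zero_lt_of_lt hN⟩) ^ 2))) hGm hGm hG2 hG2 ht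
  have f3 := pinnedChain_integral_intervalIntegral_mul_of_invariant hω hl.le hβ.le hγ.le N T T ((pinnedChain ω₂ lam β γ).gibbsMeasure N T) hinv
    (f := ((pinnedChain ω₂ lam β γ).bondCurrent N ⟨0, Nat.zero_lt_of_lt hN⟩)) (h := (fun y : PhaseSpace N => γ * (T - (y.2 ⟨0, Nat.zero_lt_of_lt hN⟩) ^ 2))) hJm hGm hJ2 hG2 ht
  have f4 := pinnedChain_integral_mul_intervalIntegral_final_of_invariant hω hl.le hβ.le hγ.le N T T ((pinnedChain ω₂ lam β γ).gibbsMeasure N T) hinv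
    (f := ((pinnedChain ω₂ lam β γ).bondCurrent N ⟨0, Nat.zero_lt_of_lt hN⟩)) (k := (fun y : PhaseSpace N => (y.2 ⟨0, Nat.zero_lt_of_lt hN⟩) ^ 2 / 2 + (pinnedChain ω₂ lam β γ).U (y.1 ⟨0, Nat.zero_lt_of_lt hN⟩) + (pinnedChain ω₂ lam β γ).V (y.1 ⟨1, hN⟩ - y.1 ⟨0, Nat.zero_lt_of_lt hN⟩) / 2)) hJm hEm hJ2 hE2 ht
  have f5 := pinnedChain_integral_mul_intervalIntegral_initial_of_invariant hω hl.le hβ.le hγ.le N T T ((pinnedChain ω₂ lam β γ).gibbsMeasure N T) hinv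
    (f := ((pinnedChain ω₂ lam β γ).bondCurrent N ⟨0, Nat.zero_lt_of_lt hN⟩)) (k := (fun y : PhaseSpace N => (y.2 ⟨0, Nat.zero_lt_of_lt hN⟩) ^ 2 / 2 + (pinnedChain ω₂ lam β γ).U (y.1 ⟨0, Nat.zero_lt_of_lt hN⟩) + (pinnedChain ω₂ lam β γ).V (y.1 ⟨1, hN⟩ - y.1 ⟨0, Nat.zero_lt_of_lt hN⟩) / 2)) hJm hEm hJ2 hE2 ht
  have f6 := pinnedChain_integral_mul_intervalIntegral_final_of_invariant hω hl.le hβ.le hγ.le N T T ((pinnedChain ω₂ lam β γ).gibbsMeasure N T) hinv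
    (f := (fun y : PhaseSpace N => γ * (T - (y.2 ⟨0, Nat.zero_lt_of_lt hN⟩) ^ 2))) (k := (fun y : PhaseSpace N => (y.2 ⟨0, Nat.zero_lt_of_lt hN⟩) ^ 2 / 2 + (pinnedChain ω₂ lam β γ).U (y.1 ⟨0, Nat.zero_lt_of_lt hN⟩) + (pinnedChain ω₂ lam β γ).V (y.1 ⟨1, hN⟩ - y.1 ⟨0, Nat.zero_lt_of_lt hN⟩) / 2)) hGm hEm hG2 hE2 ht
  have f7 := pinnedChain_integral_mul_intervalIntegral_initial_of_invariant hω hl.le hβ.le hγ.le N T T ((pinnedChain ω₂ lam β γ).gibbsMeasure N T) hinv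
    (f := (fun y : PhaseSpace N => γ * (T - (y.2 ⟨0, Nat.zero_lt_of_lt hN⟩) ^ 2))) (k := (fun y : PhaseSpace N => (y.2 ⟨0, Nat.zero_lt_of_lt hN⟩) ^ 2 / 2 + (pinnedChain ω₂ lam β γ).U (y.1 ⟨0, Nat.zero_lt_of_lt hN⟩) + (pinnedChain ω₂ lam β γ).V (y.1 ⟨1, hN⟩ - y.1 ⟨0, Nat.zero_lt_of_lt hN⟩) / 2)) hGm hEm hG2 hE2 ht
  have f8 := pinnedChain_integral_intervalIntegral_mul_of_invariant hω hl.le hβ.le hγ.le N T T ((pinnedChain ω₂ lam β γ).gibbsMeasure N T) hinv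
    (f := (fun y : PhaseSpace N => γ * (T - (y.2 ⟨0, Nat.zero_lt_of_lt hN⟩) ^ 2) - (pinnedChain ω₂ lam β γ).bondCurrent N ⟨0, Nat.zero_lt_of_lt hN⟩ y)) (h := (fun y : PhaseSpace N => γ * (T - (y.2 ⟨0, Nat.zero_lt_of_lt hN⟩) ^ 2) - (pinnedChain ω₂ lam β γ).bondCurrent N ⟨0, Nat.zero_lt_of_lt hN⟩ y)) hLm hLm hL2 hL2 ht
  have f9 := pinnedChain_integral_mul_intervalIntegral_final_of_invariant hω hl.le hβ.le hγ.le N T T ((pinnedChain ω₂ lam β γ).gibbsMeasure N T) hinv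
    (f := (fun y : PhaseSpace N => γ * (T - (y.2 ⟨0, Nat.zero_lt_of_lt hN⟩) ^ 2) - (pinnedChain ω₂ lam β γ).bondCurrent N ⟨0, Nat.zero_lt_of_lt hN⟩ y)) (k := (fun y : PhaseSpace N => (y.2 ⟨0, Nat.zero_lt_of_lt hN⟩) ^ 2 / 2 + (pinnedChain ω₂ lam β γ).U (y.1 ⟨0, Nat.zero_lt_of_lt hN⟩) + (pinnedChain ω₂ lam β γ).V (y.1 ⟨1, hN⟩ - y.1 ⟨0, Nat.zero_lt_of_lt hN⟩) / 2)) hLm hEm hL2 hE2 ht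
  have f10 := pinnedChain_integral_mul_intervalIntegral_initial_of_invariant hω hl.le hβ.le hγ.le N T T ((pinnedChain ω₂ lam β γ).gibbsMeasure N T) hinv
    (f := (fun y : PhaseSpace N => γ * (T - (y.2 ⟨0, Nat.zero_lt_of_lt hN⟩) ^ 2) - (pinnedChain ω₂ lam β γ).bondCurrent N ⟨0, Nat.zero_lt_of_lt hN⟩ y)) (k := (fun y : PhaseSpace N => (y.2 ⟨0, Nat.zero_lt_of_lt hN⟩) ^ 2 / 2 + (pinnedChain ω₂ lam β γ).U (y.1 ⟨0, Nat.zero_lt_of_lt hN⟩) + (pinnedChain ω₂ lam β γ).V (y.1 ⟨1, hN⟩ - y.1 ⟨0, Nat.zero_lt_of_lt hN⟩) / 2)) hLm hEm hL2 hE2 ht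
  have f11 := pinnedChain_pathCorr_eq_of_nonneg hω hl.le hβ.le hγ.le N T T ((pinnedChain ω₂ lam β γ).gibbsMeasure N T) hinv
    (f := (fun y : PhaseSpace N => (y.2 ⟨0, Nat.zero_lt_of_lt hN⟩) ^ 2 / 2 + (pinnedChain ω₂ lam β γ).U (y.1 ⟨0, Nat.zero_lt_of_lt hN⟩) + (pinnedChain ω₂ lam β γ).V (y.1 ⟨1, hN⟩ - y.1 ⟨0, Nat.zero_lt_of_lt hN⟩) / 2)) (h := (fun y : PhaseSpace N => (y.2 ⟨0, Nat.zero_lt_of_lt hN⟩) ^ 2 / 2 + (pinnedChain ω₂ lam β γ).U (y.1 ⟨0, Nat.zero_lt_of_lt hN⟩) + (pinnedChain ω₂ lam β γ).V (y.1 ⟨1, hN⟩ - y.1 ⟨0, Nat.zero_lt_of_lt hN⟩) / 2)) hEm hEm hE2 hE2 ht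
  have f12 := (pinnedChain_integrable_sq_solMap_of_invariant hω hl.le hβ.le hγ.le N T T ((pinnedChain ω₂ lam β γ).gibbsMeasure N T) hinv
    (f := (fun y : PhaseSpace N => (y.2 ⟨0, Nat.zero_lt_of_lt hN⟩) ^ 2 / 2 + (pinnedChain ω₂ lam β γ).U (y.1 ⟨0, Nat.zero_lt_of_lt hN⟩) + (pinnedChain ω₂ lam β γ).V (y.1 ⟨1, hN⟩ - y.1 ⟨0, Nat.zero_lt_of_lt hN⟩) / 2)) hE2 t).2
  have f13 := (pinnedChain_integrable_sq_solMap_of_invariant hω hl.le hβ.le hγ.le N T T ((pinnedChain ω₂ lam β γ).gibbsMeasure N T) hinv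
    (f := (fun y : PhaseSpace N => (y.2 ⟨0, Nat.zero_lt_of_lt hN⟩) ^ 2 / 2 + (pinnedChain ω₂ lam β γ).U (y.1 ⟨0, Nat.zero_lt_of_lt hN⟩) + (pinnedChain ω₂ lam β γ).V (y.1 ⟨1, hN⟩ - y.1 ⟨0, Nat.zero_lt_of_lt hN⟩) / 2)) hE2 0).2
  -- Dynkin (hypothesis) integrated, triangle identities, substitutions
  have d1 := pinnedChain_integral_mul_act_sub_of_dynkin hω hl.le hβ.le hγ.le N T T ((pinnedChain ω₂ lam β γ).gibbsMeasure N T) hinv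
    (f := (fun y : PhaseSpace N => (y.2 ⟨0, Nat.zero_lt_of_lt hN⟩) ^ 2 / 2 + (pinnedChain ω₂ lam β γ).U (y.1 ⟨0, Nat.zero_lt_of_lt hN⟩) + (pinnedChain ω₂ lam β γ).V (y.1 ⟨1, hN⟩ - y.1 ⟨0, Nat.zero_lt_of_lt hN⟩) / 2)) (e := (fun y : PhaseSpace N => (y.2 ⟨0, Nat.zero_lt_of_lt hN⟩) ^ 2 / 2 + (pinnedChain ω₂ lam β γ).U (y.1 ⟨0, Nat.zero_lt_of_lt hN⟩) + (pinnedChain ω₂ lam β γ).V (y.1 ⟨1, hN⟩ - y.1 ⟨0, Nat.zero_lt_of_lt hN⟩) / 2)) (ℓ := (fun y : PhaseSpace N => γ * (T - (y.2 ⟨0, Nat.zero_lt_of_lt hN⟩) ^ 2) - (pinnedChain ω₂ lam β γ).bondCurrent N ⟨0, Nat.zero_lt_of_lt hN⟩ y)) hEm hEm hLm hE2 hE2 hL2 hdyn ht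
  have d2 : ∀ r ∈ uIcc (0 : ℝ) t,
      (∫ y, (γ * (T - (y.2 ⟨0, Nat.zero_lt_of_lt hN⟩) ^ 2) - (pinnedChain ω₂ lam β γ).bondCurrent N ⟨0, Nat.zero_lt_of_lt hN⟩ y) * (∫ y', ((y'.2 ⟨0, Nat.zero_lt_of_lt hN⟩) ^ 2 / 2 + (pinnedChain ω₂ lam β γ).U (y'.1 ⟨0, Nat.zero_lt_of_lt hN⟩) + (pinnedChain ω₂ lam β γ).V (y'.1 ⟨1, hN⟩ - y'.1 ⟨0, Nat.zero_lt_of_lt hN⟩) / 2) ∂((pinnedChain ω₂ lam β γ).transitionKernel N T T r.toNNReal) y) ∂((pinnedChain ω₂ lam β γ).gibbsMeasure N T)) - ∫ y, (γ * (T - (y.2 ⟨0, Nat.zero_lt_of_lt hN⟩) ^ 2) - (pinnedChain ω₂ lam β γ).bondCurrent N ⟨0, Nat.zero_lt_of_lt hN⟩ y) * ((y.2 ⟨0, Nat.zero_lt_of_lt hN⟩) ^ 2 / 2 + (pinnedChain ω₂ lam β γ).U (y.1 ⟨0, Nat.zero_lt_of_lt hN⟩) + (pinnedChain ω₂ lam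 β γ).V (y.1 ⟨1, hN⟩ - y.1 ⟨0, Nat.zero_lt_of_lt hN⟩) / 2) ∂((pinnedChain ω₂ lam β γ).gibbsMeasure N T) =
        ∫ s in (0 : ℝ)..r, ∫ y, (γ * (T - (y.2 ⟨0, Nat.zero_lt_of_lt hN⟩) ^ 2) - (pinnedChain ω₂ lam β γ).bondCurrent N ⟨0, Nat.zero_lt_of_lt hN⟩ y) * (∫ y', (γ * (T - (y'.2 ⟨0, Nat.zero_lt_of_lt hN⟩) ^ 2) - (pinnedChain ω₂ lam β γ).bondCurrent N ⟨0, Nat.zero_lt_of_lt hN⟩ y') ∂((pinnedChain ω₂ lam β γ).transitionKernel N T T s.toNNReal) y) ∂((pinnedChain ω₂ lam β γ).gibbsMeasure N T) := by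
    intro r hr
    rw [uIcc_of_le ht] at hr
    exact pinnedChain_integral_mul_act_sub_of_dynkin hω hl.le hβ.le hγ.le N T T ((pinnedChain ω₂ lam β γ).gibbsMeasure N T) hinv
      (f := (fun y : PhaseSpace N => γ * (T - (y.2 ⟨0, Nat.zero_lt_of_lt hN⟩) ^ 2) - (pinnedChain ω₂ lam β γ).bondCurrent N ⟨0, Nat.zero_lt_of_lt hN⟩ y)) (e := (fun y : PhaseSpace N => (y.2 ⟨0, Nat.zero_lt_of_lt hN⟩) ^ 2 / 2 + (pinnedChain ω₂ lam β γ).U (y.1 ⟨0, Nat.zero_lt_of_lt hN⟩) + (pinnedChain ω₂ lam β γ).V (y.1 ⟨1, hN⟩ - y.1 ⟨0, Nat.zero_lt_of_lt hN⟩) / 2)) (ℓ := (fun y : PhaseSpace N => γ * (T - (y.2 ⟨0, Nat.zero_lt_of_lt hN⟩) ^ 2) - (pinnedChain ω₂ lam β γ).bondCurrent N ⟨0, Nat.zero_lt_of_lt hN⟩ y)) hLm hEm hLm hL2 hE2 hL2 hdyn hr.1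
  have triL := pinnedChain_integral_integral_kernelPairing_triangle hω hl.le hβ.le hγ.le N T T ((pinnedChain ω₂ lam β γ).gibbsMeasure N T) hinv
    (f := (fun y : PhaseSpace N => γ * (T - (y.2 ⟨0, Nat.zero_lt_of_lt hN⟩) ^ 2) - (pinnedChain ω₂ lam β γ).bondCurrent N ⟨0, Nat.zero_lt_of_lt hN⟩ y)) (h := (fun y : PhaseSpace N => γ * (T - (y.2 ⟨0, Nat.zero_lt_of_lt hN⟩) ^ 2) - (pinnedChain ω₂ lam β γ).bondCurrent N ⟨0, Nat.zero_lt_of_lt hN⟩ y)) hLm hLm hL2 hL2 ht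
  have triK := pinnedChain_integral_integral_kernelPairing_triangle hω hl.le hβ.le hγ.le N T T ((pinnedChain ω₂ lam β γ).gibbsMeasure N T) hinv
    (f := (fun y : PhaseSpace N => (y.2 ⟨0, Nat.zero_lt_of_lt hN⟩) ^ 2 - T)) (h := (fun y : PhaseSpace N => (y.2 ⟨0, Nat.zero_lt_of_lt hN⟩) ^ 2 - T)) hKm hKm hK2 hK2 ht
  have subJ : ∫ s in (0 : ℝ)..t, ∫ y, (pinnedChain ω₂ lam β γ).bondCurrent N ⟨0, Nat.zero_lt_of_lt hN⟩ y * (∫ y', ((y'.2 ⟨0, Nat.zero_lt_of_lt hN⟩) ^ 2 / 2 + (pinnedChain ω₂ lam β γ).U (y'.1 ⟨0, Nat.zero_lt_of_lt hN⟩) + (pinnedChain ω₂ lam β γ).V (y'.1 ⟨1, hN⟩ - y'.1 ⟨0, Nat.zero_lt_of_lt hN⟩) / 2) ∂((pinnedChain ω₂ lam β γ).transitionKernel N T T (t - s).toNNReal) y) ∂((pinnedChain ω₂ lam β γ).gibbsMeasure N T) = ∫ s in (0 : ℝ)..t, ∫ y, (pinnedChain ω₂ lam β γ).bondCurrent N ⟨0,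 Nat.zero_lt_of_lt hN⟩ y * (∫ y', ((y'.2 ⟨0, Nat.zero_lt_of_lt hN⟩) ^ 2 / 2 + (pinnedChain ω₂ lam β γ).U (y'.1 ⟨0, Nat.zero_lt_of_lt hN⟩) + (pinnedChain ω₂ lam β γ).V (y'.1 ⟨1, hN⟩ - y'.1 ⟨0, Nat.zero_lt_of_lt hN⟩) / 2) ∂((pinnedChain ω₂ lam β γ).transitionKernel N T T s.toNNReal) y) ∂((pinnedChain ω₂ lam β γ).gibbsMeasure N T) := by
    have h := intervalIntegral.integral_comp_sub_left
      (fun r : ℝ => ∫ y, (pinnedChain ω₂ lam β γ).bondCurrent N ⟨0, Nat.zero_lt_of_lt hN⟩ y * (∫ y', ((y'.2 ⟨0, Nat.zero_lt_of_lt hN⟩) ^ 2 / 2 + (pinnedChain ω₂ lam β γ).U (y'.1 ⟨0, Nat.zero_lt_of_lt hN⟩) + (pinnedChain ω₂ lam β γ).V (y'.1 ⟨1, hN⟩ - y'.1 ⟨0, Nat.zero_lt_of_lt hN⟩) / 2) ∂((pinnedChain ω₂ lam β γ).transitionKernel N T T r.toNNReal) y) ∂((pinnedChain ω₂ lam β γ).gibbsMeasure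 N T)) t (a := 0) (b := t)
    simp only [sub_self, sub_zero] at h
    exact h
  have subG : ∫ s in (0 : ℝ)..t, ∫ y, γ * (T - (y.2 ⟨0, Nat.zero_lt_of_lt hN⟩) ^ 2) * (∫ y', ((y'.2 ⟨0, Nat.zero_lt_of_lt hN⟩) ^ 2 / 2 + (pinnedChain ω₂ lam β γ).U (y'.1 ⟨0, Nat.zero_lt_of_lt hN⟩) + (pinnedChain ω₂ lam β γ).V (y'.1 ⟨1, hN⟩ - y'.1 ⟨0, Nat.zero_lt_of_lt hN⟩) / 2) ∂((pinnedChain ω₂ lam β γ).transitionKernel N T T (t - s).toNNReal) y) ∂((pinnedChain ω₂ lam β γ).gibbsMeasure N T) = ∫ s in (0 : ℝ)..t, ∫ y, γ * (T - (y.2 ⟨0, Nat.zero_lt_of_lt hN⟩) ^ 2) * (∫ y', ((y'.2 ⟨0, Nat.zero_lt_of_lt hN⟩) ^ 2 / 2 + (pinnedChain ω₂ lam β γ).U (y'.1 ⟨0, Nat.zero_lt_of_lt hN⟩) + (pinnedChain ω₂ lam β γ).V (y'.1 ⟨1, hN⟩ - y'.1 ⟨0, Nat.zero_lt_of_lt hN⟩)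 / 2) ∂((pinnedChain ω₂ lam β γ).transitionKernel N T T s.toNNReal) y) ∂((pinnedChain ω₂ lam β γ).gibbsMeasure N T) := by
    have h := intervalIntegral.integral_comp_sub_left
      (fun r : ℝ => ∫ y, γ * (T - (y.2 ⟨0, Nat.zero_lt_of_lt hN⟩) ^ 2) * (∫ y', ((y'.2 ⟨0, Nat.zero_lt_of_lt hN⟩) ^ 2 / 2 + (pinnedChain ω₂ lam β γ).U (y'.1 ⟨0, Nat.zero_lt_of_lt hN⟩) + (pinnedChain ω₂ lam β γ).V (y'.1 ⟨1, hN⟩ - y'.1 ⟨0, Nat.zero_lt_of_lt hN⟩) / 2) ∂((pinnedChain ω₂ lam β γ).transitionKernel N T T r.toNNReal) y) ∂((pinnedChain ω₂ lam β γ).gibbsMeasure N T)) t (a := 0) (b := t)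
    simp only [sub_self, sub_zero] at h
    exact h
  have subL : ∫ s in (0 : ℝ)..t, ∫ y, (γ * (T - (y.2 ⟨0, Nat.zero_lt_of_lt hN⟩) ^ 2) - (pinnedChain ω₂ lam β γ).bondCurrent N ⟨0, Nat.zero_lt_of_lt hN⟩ y) * (∫ y', ((y'.2 ⟨0, Nat.zero_lt_of_lt hN⟩) ^ 2 / 2 + (pinnedChain ω₂ lam β γ).U (y'.1 ⟨0, Nat.zero_lt_of_lt hN⟩) + (pinnedChain ω₂ lam β γ).V (y'.1 ⟨1, hN⟩ - y'.1 ⟨0, Nat.zero_lt_of_lt hN⟩) / 2) ∂((pinnedChain ω₂ lam β γ).transitionKernel N T T (t - s).toNNReal) y) ∂((pinnedChain ω₂ lam β γ).gibbsMeasure N T) = ∫ s in (0 : ℝ)..t, ∫ y, (γ * (T - (y.2 ⟨0, Nat.zero_lt_of_lt hN⟩) ^ 2) - (pinnedChain ω₂ lam β γ).bondCurrent N ⟨0, Nat.zero_lt_of_lt hN⟩ y) * (∫ y', ((y'.2 ⟨0, Nat.zero_lt_of_lt hN⟩) ^ 2 / 2 + (pinnedChain ω₂ lam β γ).U (y'.1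 ⟨0, Nat.zero_lt_of_lt hN⟩) + (pinnedChain ω₂ lam β γ).V (y'.1 ⟨1, hN⟩ - y'.1 ⟨0, Nat.zero_lt_of_lt hN⟩) / 2) ∂((pinnedChain ω₂ lam β γ).transitionKernel N T T s.toNNReal) y) ∂((pinnedChain ω₂ lam β γ).gibbsMeasure N T) := by
    have h := intervalIntegral.integral_comp_sub_left
      (fun r : ℝ => ∫ y, (γ * (T - (y.2 ⟨0, Nat.zero_lt_of_lt hN⟩) ^ 2) - (pinnedChain ω₂ lam β γ).bondCurrent N ⟨0, Nat.zero_lt_of_lt hN⟩ y) * (∫ y', ((y'.2 ⟨0, Nat.zero_lt_of_lt hN⟩) ^ 2 / 2 + (pinnedChain ω₂ lam β γ).U (y'.1 ⟨0, Nat.zero_lt_of_lt hN⟩) + (pinnedChain ω₂ lam β γ).V (y'.1 ⟨1, hN⟩ - y'.1 ⟨0, Nat.zero_lt_of_lt hN⟩) / 2) ∂((pinnedChain ω₂ lam β γ).transitionKernel N T T r.toNNReal) y) ∂((pinnedChain ω₂ lam β γ).gibbsMeasure N T)) t (a := 0) (b := t)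
    simp only [sub_self, sub_zero] at h
    exact h
  -- the Dynkin consequences: `∫₀ᵗ (t-r) ⟨ℓ, P_r ℓ⟩ dr = ∫₀ᵗ ⟨ℓ, P_r e⟩ dr - t ⟨ℓ, e⟩`
  have hIle : IntervalIntegrable (fun r : ℝ => ∫ y, (γ * (T - (y.2 ⟨0, Nat.zero_lt_of_lt hN⟩) ^ 2) - (pinnedChain ω₂ lam β γ).bondCurrent N ⟨0, Nat.zero_lt_of_lt hN⟩ y) * (∫ y', ((y'.2 ⟨0, Nat.zero_lt_of_lt hN⟩) ^ 2 / 2 + (pinnedChain ω₂ lam β γ).U (y'.1 ⟨0, Nat.zero_lt_of_lt hN⟩) + (pinnedChain ω₂ lam β γ).V (y'.1 ⟨1, hN⟩ - y'.1 ⟨0, Nat.zero_lt_of_lt hN⟩) / 2) ∂((pinnedChain ω₂ lam β γ).transitionKernel N T T r.toNNReal) y) ∂((pinnedChain ω₂ lam β γ).gibbsMeasure N T)) volume 0 t :=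
    pinnedChain_intervalIntegrable_kernelPairing hω hl.le hβ.le hγ.le N T T ((pinnedChain ω₂ lam β γ).gibbsMeasure N T) hinv hLm hEm hL2 hE2 0 t
  have dyn2 : ∫ r in (0 : ℝ)..t, (t - r) * (∫ y, (γ * (T - (y.2 ⟨0, Nat.zero_lt_of_lt hN⟩) ^ 2) - (pinnedChain ω₂ lam β γ).bondCurrent N ⟨0, Nat.zero_lt_of_lt hN⟩ y) * (∫ y', (γ * (T - (y'.2 ⟨0, Nat.zero_lt_of_lt hN⟩) ^ 2) - (pinnedChain ω₂ lam β γ).bondCurrent N ⟨0, Nat.zero_lt_of_lt hN⟩ y') ∂((pinnedChain ω₂ lam β γ).transitionKernel N T T r.toNNReal) y) ∂((pinnedChain ω₂ lam β γ).gibbsMeasure N T)) =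
      (∫ r in (0 : ℝ)..t, ∫ y, (γ * (T - (y.2 ⟨0, Nat.zero_lt_of_lt hN⟩) ^ 2) - (pinnedChain ω₂ lam β γ).bondCurrent N ⟨0, Nat.zero_lt_of_lt hN⟩ y) * (∫ y', ((y'.2 ⟨0, Nat.zero_lt_of_lt hN⟩) ^ 2 / 2 + (pinnedChain ω₂ lam β γ).U (y'.1 ⟨0, Nat.zero_lt_of_lt hN⟩) + (pinnedChain ω₂ lam β γ).V (y'.1 ⟨1, hN⟩ - y'.1 ⟨0, Nat.zero_lt_of_lt hN⟩) / 2) ∂((pinnedChain ω₂ lam β γ).transitionKernel N T T r.toNNReal) y) ∂((pinnedChain ω₂ lam β γ).gibbsMeasure N T)) - t * ∫ y, (γ * (T - (y.2 ⟨0, Nat.zero_lt_of_lt hN⟩) ^ 2) - (pinnedChain ω₂ lam β γ).bondCurrent N ⟨0, Nat.zero_lt_of_lt hN⟩ y) * ((y.2 ⟨0, Nat.zero_lt_of_lt hN⟩) ^ 2 / 2 + (pinnedChain ω₂ lam β γ).U (y.1 ⟨0, Nat.zero_lt_of_lt hN⟩) + (pinnedChain ω₂ lam β γ).V (y.1 ⟨1,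 hN⟩ - y.1 ⟨0, Nat.zero_lt_of_lt hN⟩) / 2) ∂((pinnedChain ω₂ lam β γ).gibbsMeasure N T) := by
    rw [← triL, intervalIntegral.integral_congr (fun r hr => (d2 r hr).symm),
      intervalIntegral.integral_sub hIle intervalIntegrable_const, intervalIntegral.integral_const]
    simp
  -- detailed balance: `⟨j, P g⟩ = -⟨g, P j⟩`, `⟨e, P g⟩ = ⟨g, P e⟩`
  have dbJG : ∀ r : ℝ, (∫ y, (pinnedChain ω₂ lam β γ).bondCurrent N ⟨0, Nat.zero_lt_of_lt hN⟩ y * (∫ y', γ * (T - (y'.2 ⟨0, Nat.zero_lt_of_lt hN⟩) ^ 2) ∂((pinnedChain ω₂ lam β γ).transitionKernel N T T r.toNNReal) y) ∂((pinnedChain ω₂ lam β γ).gibbsMeasure N T)) = -(∫ y, γ * (T - (y.2 ⟨0, Nat.zero_lt_of_lt hN⟩) ^ 2) * (∫ y', (pinnedChain ω₂ lam β γ).bondCurrent N ⟨0, Nat.zero_lt_of_lt hN⟩ y' ∂((pinnedChain ω₂ lam β γ).transitionKernel N T T r.toNNReal) y) ∂((pinnedChain ω₂ lam β γ).gibbsMeasure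 N T)) := by
    intro r
    rw [hdb r.toNNReal ((pinnedChain ω₂ lam β γ).bondCurrent N ⟨0, Nat.zero_lt_of_lt hN⟩) (fun y : PhaseSpace N => γ * (T - (y.2 ⟨0, Nat.zero_lt_of_lt hN⟩) ^ 2)) hJm hGm hJ2 hG2, ← MeasureTheory.integral_neg]
    refine integral_congr_ae (Eventually.of_forall fun y => ?_)
    simp only [Pi.neg_apply, neg_sq, OscillatorChain.bondCurrent_neg_momentum, MeasureTheory.integral_neg]
    ring
  have dbEG : ∀ s : ℝ, (∫ y, ((y.2 ⟨0, Nat.zero_lt_of_lt hN⟩) ^ 2 / 2 + (pinnedChain ω₂ lam β γ).U (y.1 ⟨0, Nat.zero_lt_of_lt hN⟩) + (pinnedChain ω₂ lam β γ).V (y.1 ⟨1, hN⟩ - y.1 ⟨0, Nat.zero_lt_of_lt hN⟩) / 2) * (∫ y', γ * (T - (y'.2 ⟨0, Nat.zero_lt_of_lt hN⟩) ^ 2) ∂((pinnedChain ω₂ lam β γ).transitionKernel N T T s.toNNReal) y) ∂((pinnedChain ω₂ lam β γ).gibbsMeasure N T)) = ∫ y, γ * (T - (y.2 ⟨0, Nat.zero_lt_of_lt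 hN⟩) ^ 2) * (∫ y', ((y'.2 ⟨0, Nat.zero_lt_of_lt hN⟩) ^ 2 / 2 + (pinnedChain ω₂ lam β γ).U (y'.1 ⟨0, Nat.zero_lt_of_lt hN⟩) + (pinnedChain ω₂ lam β γ).V (y'.1 ⟨1, hN⟩ - y'.1 ⟨0, Nat.zero_lt_of_lt hN⟩) / 2) ∂((pinnedChain ω₂ lam β γ).transitionKernel N T T s.toNNReal) y) ∂((pinnedChain ω₂ lam β γ).gibbsMeasure N T) := by
    intro s
    rw [hdb s.toNNReal (fun y : PhaseSpace N => (y.2 ⟨0, Nat.zero_lt_of_lt hN⟩) ^ 2 / 2 + (pinnedChain ω₂ lam β γ).U (y.1 ⟨0, Nat.zero_lt_of_lt hN⟩) + (pinnedChain ω₂ lam β γ).V (y.1 ⟨1, hN⟩ - y.1 ⟨0, Nat.zero_lt_of_lt hN⟩) / 2) (fun y : PhaseSpace N => γ * (T - (y.2 ⟨0, Nat.zero_lt_of_lt hN⟩) ^ 2)) hEm hGm hE2 hG2]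
    refine integral_congr_ae (Eventually.of_forall fun y => ?_)
    simp only [Pi.neg_apply, neg_sq]
  have hXD0 : ∫ p, (∫ s in (0 : ℝ)..t, (pinnedChain ω₂ lam β γ).bondCurrent N ⟨0, Nat.zero_lt_of_lt hN⟩ ((pinnedChain ω₂ lam β γ).solMap N T T s p.1 (pairPath p.2))) * (∫ s in (0 : ℝ)..t, γ * (T - (((pinnedChain ω₂ lam β γ).solMap N T T s p.1 (pairPath p.2)).2 ⟨0, Nat.zero_lt_of_lt hN⟩) ^ 2)) ∂(((pinnedChain ω₂ lam β γ).gibbsMeasure N T).prod wienerPair) = 0 := by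
    rw [f3]
    have h0 : ∀ r ∈ uIcc (0 : ℝ) t, (t - r) * ((∫ y, (pinnedChain ω₂ lam β γ).bondCurrent N ⟨0, Nat.zero_lt_of_lt hN⟩ y * (∫ y', γ * (T - (y'.2 ⟨0, Nat.zero_lt_of_lt hN⟩) ^ 2) ∂((pinnedChain ω₂ lam β γ).transitionKernel N T T r.toNNReal) y) ∂((pinnedChain ω₂ lam β γ).gibbsMeasure N T)) + ∫ y, γ * (T - (y.2 ⟨0, Nat.zero_lt_of_lt hN⟩) ^ 2) * (∫ y', (pinnedChain ω₂ lam β γ).bondCurrent N ⟨0, Nat.zero_lt_of_lt hN⟩ y' ∂((pinnedChain ω₂ lam β γ).transitionKernel N T T r.toNNReal) y) ∂((pinnedChain ω₂ lam β γ).gibbsMeasure N T)) = 0 := by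
      intro r _
      rw [dbJG r]
      ring
    rw [intervalIntegral.integral_congr h0]
    simp
  have hED0 : ∫ p, ((((pinnedChain ω₂ lam β γ).solMap N T T t p.1 (pairPath p.2)).2 ⟨0, Nat.zero_lt_of_lt hN⟩) ^ 2 / 2 + (pinnedChain ω₂ lam β γ).U (((pinnedChain ω₂ lam β γ).solMap N T T t p.1 (pairPath p.2)).1 ⟨0, Nat.zero_lt_of_lt hN⟩) + (pinnedChain ω₂ lam β γ).V (((pinnedChain ω₂ lam β γ).solMap N T T t p.1 (pairPath p.2)).1 ⟨1, hN⟩ - ((pinnedChain ω₂ lam β γ).solMap N T T t p.1 (pairPath p.2)).1 ⟨0, Nat.zero_lt_of_lt hN⟩) / 2) * (∫ s in (0 : ℝ)..t, γ * (T - (((pinnedChain ω₂ lam β γ).solMap N T T s p.1 (pairPath p.2)).2 ⟨0, Nat.zero_lt_of_lt hN⟩) ^ 2)) ∂(((pinnedChain ω₂ lam β γ).gibbsMeasure N T).prod wienerPair) = ∫ p, ((((pinnedChain ω₂ lam β γ).solMap N T T 0 p.1 (pairPath p.2)).2 ⟨0, Nat.zero_lt_of_lt hN⟩) ^ 2 /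 2 + (pinnedChain ω₂ lam β γ).U (((pinnedChain ω₂ lam β γ).solMap N T T 0 p.1 (pairPath p.2)).1 ⟨0, Nat.zero_lt_of_lt hN⟩) + (pinnedChain ω₂ lam β γ).V (((pinnedChain ω₂ lam β γ).solMap N T T 0 p.1 (pairPath p.2)).1 ⟨1, hN⟩ - ((pinnedChain ω₂ lam β γ).solMap N T T 0 p.1 (pairPath p.2)).1 ⟨0, Nat.zero_lt_of_lt hN⟩) / 2) * (∫ s in (0 : ℝ)..t, γ * (T - (((pinnedChain ω₂ lam β γ).solMap N T T s p.1 (pairPath p.2)).2 ⟨0, Nat.zero_lt_of_lt hN⟩) ^ 2)) ∂(((pinnedChain ω₂ lam β γ).gibbsMeasure N T).prod wienerPair) := by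
    rw [f6, f7, subG]
    exact intervalIntegral.integral_congr fun s _ => (dbEG s).symm
  -- `⟨g, P g⟩ = γ² ⟨k, P k⟩` with `k = p₀² - T`
  have hGK : ∀ r : ℝ, (∫ y, γ * (T - (y.2 ⟨0, Nat.zero_lt_of_lt hN⟩) ^ 2) * (∫ y', γ * (T - (y'.2 ⟨0, Nat.zero_lt_of_lt hN⟩) ^ 2) ∂((pinnedChain ω₂ lam β γ).transitionKernel N T T r.toNNReal) y) ∂((pinnedChain ω₂ lam β γ).gibbsMeasure N T)) = γ ^ 2 * ∫ y, ((y.2 ⟨0, Nat.zero_lt_of_lt hN⟩) ^ 2 - T) * (∫ y', ((y'.2 ⟨0, Nat.zero_lt_of_lt hN⟩) ^ 2 - T) ∂((pinnedChain ω₂ lam β γ).transitionKernel N T T r.toNNReal) y) ∂((pinnedChain ω₂ lam β γ).gibbsMeasure N T) := by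
    intro r
    rw [← MeasureTheory.integral_const_mul]
    refine integral_congr_ae (Eventually.of_forall fun y => ?_)
    beta_reduce
    have hin : ∫ y', γ * (T - (y'.2 ⟨0, Nat.zero_lt_of_lt hN⟩) ^ 2) ∂((pinnedChain ω₂ lam β γ).transitionKernel N T T r.toNNReal) y = (-γ) * ∫ y', ((y'.2 ⟨0, Nat.zero_lt_of_lt hN⟩) ^ 2 - T) ∂((pinnedChain ω₂ lam β γ).transitionKernel N T T r.toNNReal) y := by
      rw [← MeasureTheory.integral_const_mul]
      refine integral_congr_ae (Eventually.of_forall fun y' => ?_)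
      ring
    rw [hin]
    ring
  have f2' : ∫ p, (∫ s in (0 : ℝ)..t, γ * (T - (((pinnedChain ω₂ lam β γ).solMap N T T s p.1 (pairPath p.2)).2 ⟨0, Nat.zero_lt_of_lt hN⟩) ^ 2)) * (∫ s in (0 : ℝ)..t, γ * (T - (((pinnedChain ω₂ lam β γ).solMap N T T s p.1 (pairPath p.2)).2 ⟨0, Nat.zero_lt_of_lt hN⟩) ^ 2)) ∂(((pinnedChain ω₂ lam β γ).gibbsMeasure N T).prod wienerPair) = 2 * γ ^ 2 * ∫ r in (0 : ℝ)..t, (t - r) * ∫ y, ((y.2 ⟨0, Nat.zero_lt_of_lt hN⟩) ^ 2 - T) * (∫ y', ((y'.2 ⟨0, Nat.zero_lt_of_lt hN⟩) ^ 2 - T) ∂((pinnedChain ω₂ lam β γ).transitionKernel N T T r.toNNReal) y) ∂((pinnedChain ω₂ lam β γ).gibbsMeasure N T) := by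
    rw [f2, ← intervalIntegral.integral_const_mul]
    refine intervalIntegral.integral_congr fun r _ => ?_
    rw [hGK r]
    ring
  have f1' : ∫ p, (∫ s in (0 : ℝ)..t, (pinnedChain ω₂ lam β γ).bondCurrent N ⟨0, Nat.zero_lt_of_lt hN⟩ ((pinnedChain ω₂ lam β γ).solMap N T T s p.1 (pairPath p.2))) * (∫ s in (0 : ℝ)..t, (pinnedChain ω₂ lam β γ).bondCurrent N ⟨0, Nat.zero_lt_of_lt hN⟩ ((pinnedChain ω₂ lam β γ).solMap N T T s p.1 (pairPath p.2))) ∂(((pinnedChain ω₂ lam β γ).gibbsMeasure N T).prod wienerPair) = 2 * ∫ s in (0 : ℝ)..t, (t - s) * ∫ y, (pinnedChain ω₂ lam β γ).bondCurrent N ⟨0, Nat.zero_lt_of_lt hN⟩ y * (∫ y', (pinnedChain ω₂ lam β γ).bondCurrent N ⟨0, Nat.zero_lt_of_lt hN⟩ y' ∂((pinnedChain ω₂ lam β γ).transitionKernel N T T s.toNNReal) y) ∂((pinnedChain ω₂ lam β γ).gibbsMeasure N T) := by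
    rw [f1, ← intervalIntegral.integral_const_mul]
    refine intervalIntegral.integral_congr fun r _ => ?_
    ring
  have f8' : ∫ p, (∫ s in (0 : ℝ)..t, (γ * (T - (((pinnedChain ω₂ lam β γ).solMap N T T s p.1 (pairPath p.2)).2 ⟨0, Nat.zero_lt_of_lt hN⟩) ^ 2) - (pinnedChain ω₂ lam β γ).bondCurrent N ⟨0, Nat.zero_lt_of_lt hN⟩ ((pinnedChain ω₂ lam β γ).solMap N T T s p.1 (pairPath p.2)))) * (∫ s in (0 : ℝ)..t, (γ * (T - (((pinnedChain ω₂ lam β γ).solMap N T T s p.1 (pairPath p.2)).2 ⟨0, Nat.zero_lt_of_lt hN⟩) ^ 2) - (pinnedChain ω₂ lam β γ).bondCurrent N ⟨0, Nat.zero_lt_of_lt hN⟩ ((pinnedChain ω₂ lam β γ).solMap N T T s p.1 (pairPath p.2)))) ∂(((pinnedChain ω₂ lam β γ).gibbsMeasure N T).prod wienerPair) = 2 * ∫ r in (0 : ℝ)..t, (t - r) * ∫ y, (γ * (T - (y.2 ⟨0, Nat.zero_lt_of_lt hN⟩) ^ 2) - (pinnedChain ω₂ lam β γ).bondCurrent N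 ⟨0, Nat.zero_lt_of_lt hN⟩ y) * (∫ y', (γ * (T - (y'.2 ⟨0, Nat.zero_lt_of_lt hN⟩) ^ 2) - (pinnedChain ω₂ lam β γ).bondCurrent N ⟨0, Nat.zero_lt_of_lt hN⟩ y') ∂((pinnedChain ω₂ lam β γ).transitionKernel N T T r.toNNReal) y) ∂((pinnedChain ω₂ lam β γ).gibbsMeasure N T) := by
    rw [f8, ← intervalIntegral.integral_const_mul]
    refine intervalIntegral.integral_congr fun r _ => ?_
    ring
  -- the middle term of the stub
  have hIKK : IntervalIntegrable (fun u : ℝ => ∫ y, ((y.2 ⟨0, Nat.zero_lt_of_lt hN⟩) ^ 2 - T) * (∫ y', ((y'.2 ⟨0, Nat.zero_lt_of_lt hN⟩) ^ 2 - T) ∂((pinnedChain ω₂ lam β γ).transitionKernel N T T u.toNNReal) y) ∂((pinnedChain ω₂ lam β γ).gibbsMeasure N T)) volume 0 t :=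
    pinnedChain_intervalIntegrable_kernelPairing hω hl.le hβ.le hγ.le N T T ((pinnedChain ω₂ lam β γ).gibbsMeasure N T) hinv hKm hKm hK2 hK2 0 t
  have hprim : IntervalIntegrable (fun s : ℝ => ∫ u in (0 : ℝ)..s, ∫ y, ((y.2 ⟨0, Nat.zero_lt_of_lt hN⟩) ^ 2 - T) * (∫ y', ((y'.2 ⟨0, Nat.zero_lt_of_lt hN⟩) ^ 2 - T) ∂((pinnedChain ω₂ lam β γ).transitionKernel N T T u.toNNReal) y) ∂((pinnedChain ω₂ lam β γ).gibbsMeasure N T)) volume 0 t :=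
    (intervalIntegral.continuous_primitive (fun a b =>
      pinnedChain_intervalIntegrable_kernelPairing hω hl.le hβ.le hγ.le N T T ((pinnedChain ω₂ lam β γ).gibbsMeasure N T) hinv hKm hKm hK2 hK2 a b) 0).intervalIntegrable _ _
  have hW : 4 * γ * T ^ 2 * (∫ s in (0 : ℝ)..t, (1 - γ / T ^ 2 * ∫ u in (0 : ℝ)..s, ∫ y, ((y.2 ⟨0, Nat.zero_lt_of_lt hN⟩) ^ 2 - T) * (∫ y', ((y'.2 ⟨0, Nat.zero_lt_of_lt hN⟩) ^ 2 - T) ∂((pinnedChain ω₂ lam β γ).transitionKernel N T T u.toNNReal) y) ∂((pinnedChain ω₂ lam β γ).gibbsMeasure N T))) =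
      4 * γ * T ^ 2 * t - 4 * γ ^ 2 * ∫ r in (0 : ℝ)..t, (t - r) * ∫ y, ((y.2 ⟨0, Nat.zero_lt_of_lt hN⟩) ^ 2 - T) * (∫ y', ((y'.2 ⟨0, Nat.zero_lt_of_lt hN⟩) ^ 2 - T) ∂((pinnedChain ω₂ lam β γ).transitionKernel N T T r.toNNReal) y) ∂((pinnedChain ω₂ lam β γ).gibbsMeasure N T) := by
    rw [intervalIntegral.integral_sub intervalIntegrable_const (hprim.const_mul _), intervalIntegral.integral_const,
      intervalIntegral.integral_const_mul, triK]
    simp only [sub_zero, smul_eq_mul, mul_one]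
    field_simp
  -- pathwise: `∫₀ᵗ ℓ(z_s) = ∫₀ᵗ g(z_s) - ∫₀ᵗ j(z_s)` (continuity in `s`)
  have hZc : ∀ p : PhaseSpace N × WienerPair, Continuous fun s : ℝ => ((pinnedChain ω₂ lam β γ).solMap N T T s p.1 (pairPath p.2)) := fun p =>
    pinnedChain_continuous_solMap hω hl.le hβ.le hγ.le N T T p.1 (pairPath p.2)
  have hYDX : ∀ p : PhaseSpace N × WienerPair, (∫ s in (0 : ℝ)..t, (γ * (T - (((pinnedChain ω₂ lam β γ).solMap N T T s p.1 (pairPath p.2)).2 ⟨0, Nat.zero_lt_of_lt hN⟩) ^ 2) - (pinnedChain ω₂ lam β γ).bondCurrent N ⟨0, Nat.zero_lt_of_lt hN⟩ ((pinnedChain ω₂ lam β γ).solMap N T T s p.1 (pairPath p.2)))) = (∫ s in (0 : ℝ)..t, γ * (T - (((pinnedChain ω₂ lam β γ).solMap N T T s p.1 (pairPath p.2)).2 ⟨0, Nat.zero_lt_of_lt hN⟩) ^ 2)) - (∫ s in (0 : ℝ)..t, (pinnedChain ω₂ lam β γ).bondCurrent N ⟨0, Nat.zero_lt_of_lt hN⟩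 ((pinnedChain ω₂ lam β γ).solMap N T T s p.1 (pairPath p.2))) := by
    intro p
    rw [← intervalIntegral.integral_sub]
    · exact ((hGc.comp (hZc p)).intervalIntegrable _ _)
    · exact (((pinnedChain_continuous_bondCurrent ω₂ lam β γ N ⟨0, Nat.zero_lt_of_lt hN⟩).comp (hZc p)).intervalIntegrable _ _)
  -- integrability of the products of path functionals
  have iXX := pinnedChain_integrable_intervalIntegral_mul_of_invariant hω hl.le hβ.le hγ.le N T T ((pinnedChain ω₂ lam β γ).gibbsMeasure N T) hinv
    (f := ((pinnedChain ω₂ lam β γ).bondCurrent N ⟨0, Nat.zero_lt_of_lt hN⟩)) (h := ((pinnedChain ω₂ lam β γ).bondCurrent N ⟨0, Nat.zero_lt_of_lt hN⟩)) hJm hJm hJ2 hJ2 ht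
  have iDD := pinnedChain_integrable_intervalIntegral_mul_of_invariant hω hl.le hβ.le hγ.le N T T ((pinnedChain ω₂ lam β γ).gibbsMeasure N T) hinv
    (f := (fun y : PhaseSpace N => γ * (T - (y.2 ⟨0, Nat.zero_lt_of_lt hN⟩) ^ 2))) (h := (fun y : PhaseSpace N => γ * (T - (y.2 ⟨0, Nat.zero_lt_of_lt hN⟩) ^ 2))) hGm hGm hG2 hG2 ht
  have iXD := pinnedChain_integrable_intervalIntegral_mul_of_invariant hω hl.le hβ.le hγ.le N T T ((pinnedChain ω₂ lam β γ).gibbsMeasure N T) hinv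
    (f := ((pinnedChain ω₂ lam β γ).bondCurrent N ⟨0, Nat.zero_lt_of_lt hN⟩)) (h := (fun y : PhaseSpace N => γ * (T - (y.2 ⟨0, Nat.zero_lt_of_lt hN⟩) ^ 2))) hJm hGm hJ2 hG2 ht
  have iDX := pinnedChain_integrable_intervalIntegral_mul_of_invariant hω hl.le hβ.le hγ.le N T T ((pinnedChain ω₂ lam β γ).gibbsMeasure N T) hinv
    (f := (fun y : PhaseSpace N => γ * (T - (y.2 ⟨0, Nat.zero_lt_of_lt hN⟩) ^ 2))) (h := ((pinnedChain ω₂ lam β γ).bondCurrent N ⟨0, Nat.zero_lt_of_lt hN⟩)) hGm hJm hG2 hJ2 ht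
  have itX := pinnedChain_integrable_mul_intervalIntegral_of_invariant hω hl.le hβ.le hγ.le N T T ((pinnedChain ω₂ lam β γ).gibbsMeasure N T) hinv
    (f := ((pinnedChain ω₂ lam β γ).bondCurrent N ⟨0, Nat.zero_lt_of_lt hN⟩)) (k := (fun y : PhaseSpace N => (y.2 ⟨0, Nat.zero_lt_of_lt hN⟩) ^ 2 / 2 + (pinnedChain ω₂ lam β γ).U (y.1 ⟨0, Nat.zero_lt_of_lt hN⟩) + (pinnedChain ω₂ lam β γ).V (y.1 ⟨1, hN⟩ - y.1 ⟨0, Nat.zero_lt_of_lt hN⟩) / 2)) hJm hEm hJ2 hE2 t ht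
  have i0X := pinnedChain_integrable_mul_intervalIntegral_of_invariant hω hl.le hβ.le hγ.le N T T ((pinnedChain ω₂ lam β γ).gibbsMeasure N T) hinv
    (f := ((pinnedChain ω₂ lam β γ).bondCurrent N ⟨0, Nat.zero_lt_of_lt hN⟩)) (k := (fun y : PhaseSpace N => (y.2 ⟨0, Nat.zero_lt_of_lt hN⟩) ^ 2 / 2 + (pinnedChain ω₂ lam β γ).U (y.1 ⟨0, Nat.zero_lt_of_lt hN⟩) + (pinnedChain ω₂ lam β γ).V (y.1 ⟨1, hN⟩ - y.1 ⟨0, Nat.zero_lt_of_lt hN⟩) / 2)) hJm hEm hJ2 hE2 0 ht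
  have itD := pinnedChain_integrable_mul_intervalIntegral_of_invariant hω hl.le hβ.le hγ.le N T T ((pinnedChain ω₂ lam β γ).gibbsMeasure N T) hinv
    (f := (fun y : PhaseSpace N => γ * (T - (y.2 ⟨0, Nat.zero_lt_of_lt hN⟩) ^ 2))) (k := (fun y : PhaseSpace N => (y.2 ⟨0, Nat.zero_lt_of_lt hN⟩) ^ 2 / 2 + (pinnedChain ω₂ lam β γ).U (y.1 ⟨0, Nat.zero_lt_of_lt hN⟩) + (pinnedChain ω₂ lam β γ).V (y.1 ⟨1, hN⟩ - y.1 ⟨0, Nat.zero_lt_of_lt hN⟩) / 2)) hGm hEm hG2 hE2 t ht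
  have i0D := pinnedChain_integrable_mul_intervalIntegral_of_invariant hω hl.le hβ.le hγ.le N T T ((pinnedChain ω₂ lam β γ).gibbsMeasure N T) hinv
    (f := (fun y : PhaseSpace N => γ * (T - (y.2 ⟨0, Nat.zero_lt_of_lt hN⟩) ^ 2))) (k := (fun y : PhaseSpace N => (y.2 ⟨0, Nat.zero_lt_of_lt hN⟩) ^ 2 / 2 + (pinnedChain ω₂ lam β γ).U (y.1 ⟨0, Nat.zero_lt_of_lt hN⟩) + (pinnedChain ω₂ lam β γ).V (y.1 ⟨1, hN⟩ - y.1 ⟨0, Nat.zero_lt_of_lt hN⟩) / 2)) hGm hEm hG2 hE2 0 ht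
  have itt := (pinnedChain_integrable_sq_solMap_of_invariant hω hl.le hβ.le hγ.le N T T ((pinnedChain ω₂ lam β γ).gibbsMeasure N T) hinv
    (f := (fun y : PhaseSpace N => (y.2 ⟨0, Nat.zero_lt_of_lt hN⟩) ^ 2 / 2 + (pinnedChain ω₂ lam β γ).U (y.1 ⟨0, Nat.zero_lt_of_lt hN⟩) + (pinnedChain ω₂ lam β γ).V (y.1 ⟨1, hN⟩ - y.1 ⟨0, Nat.zero_lt_of_lt hN⟩) / 2)) hE2 t).1
  have i00 := (pinnedChain_integrable_sq_solMap_of_invariant hω hl.le hβ.le hγ.le N T T ((pinnedChain ω₂ lam β γ).gibbsMeasure N T) hinv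
    (f := (fun y : PhaseSpace N => (y.2 ⟨0, Nat.zero_lt_of_lt hN⟩) ^ 2 / 2 + (pinnedChain ω₂ lam β γ).U (y.1 ⟨0, Nat.zero_lt_of_lt hN⟩) + (pinnedChain ω₂ lam β γ).V (y.1 ⟨1, hN⟩ - y.1 ⟨0, Nat.zero_lt_of_lt hN⟩) / 2)) hE2 0).1
  have hm0 : Measurable fun p : PhaseSpace N × WienerPair => ((((pinnedChain ω₂ lam β γ).solMap N T T 0 p.1 (pairPath p.2)).2 ⟨0, Nat.zero_lt_of_lt hN⟩) ^ 2 / 2 + (pinnedChain ω₂ lam β γ).U (((pinnedChain ω₂ lam β γ).solMap N T T 0 p.1 (pairPath p.2)).1 ⟨0, Nat.zero_lt_of_lt hN⟩) + (pinnedChain ω₂ lam β γ).V (((pinnedChain ω₂ lam β γ).solMap N T T 0 p.1 (pairPath p.2)).1 ⟨1, hN⟩ - ((pinnedChain ω₂ lam β γ).solMap N T T 0 p.1 (pairPath p.2)).1 ⟨0, Nat.zero_lt_of_lt hN⟩) / 2) :=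
    hEm.comp (pinnedChain_measurable_solMap_pairPath hω hl.le hβ.le hγ.le N T T 0)
  have hmt : Measurable fun p : PhaseSpace N × WienerPair => ((((pinnedChain ω₂ lam β γ).solMap N T T t p.1 (pairPath p.2)).2 ⟨0, Nat.zero_lt_of_lt hN⟩) ^ 2 / 2 + (pinnedChain ω₂ lam β γ).U (((pinnedChain ω₂ lam β γ).solMap N T T t p.1 (pairPath p.2)).1 ⟨0, Nat.zero_lt_of_lt hN⟩) + (pinnedChain ω₂ lam β γ).V (((pinnedChain ω₂ lam β γ).solMap N T T t p.1 (pairPath p.2)).1 ⟨1, hN⟩ - ((pinnedChain ω₂ lam β γ).solMap N T T t p.1 (pairPath p.2)).1 ⟨0, Nat.zero_lt_of_lt hN⟩) / 2) :=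
    hEm.comp (pinnedChain_measurable_solMap_pairPath hω hl.le hβ.le hγ.le N T T t)
  have i0t : Integrable (fun p : PhaseSpace N × WienerPair => ((((pinnedChain ω₂ lam β γ).solMap N T T 0 p.1 (pairPath p.2)).2 ⟨0, Nat.zero_lt_of_lt hN⟩) ^ 2 / 2 + (pinnedChain ω₂ lam β γ).U (((pinnedChain ω₂ lam β γ).solMap N T T 0 p.1 (pairPath p.2)).1 ⟨0, Nat.zero_lt_of_lt hN⟩) + (pinnedChain ω₂ lam β γ).V (((pinnedChain ω₂ lam β γ).solMap N T T 0 p.1 (pairPath p.2)).1 ⟨1, hN⟩ - ((pinnedChain ω₂ lam β γ).solMap N T T 0 p.1 (pairPath p.2)).1 ⟨0, Nat.zero_lt_of_lt hN⟩) / 2) * ((((pinnedChain ω₂ lam β γ).solMap N T T t p.1 (pairPath p.2)).2 ⟨0, Nat.zero_lt_of_lt hN⟩) ^ 2 / 2 + (pinnedChain ω₂ lam β γ).U (((pinnedChain ω₂ lam β γ).solMap N T T t p.1 (pairPath p.2)).1 ⟨0, Nat.zero_lt_of_lt hN⟩) + (pinnedChain ω₂ lam β γ).V (((pinnedChain ω₂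 lam β γ).solMap N T T t p.1 (pairPath p.2)).1 ⟨1, hN⟩ - ((pinnedChain ω₂ lam β γ).solMap N T T t p.1 (pairPath p.2)).1 ⟨0, Nat.zero_lt_of_lt hN⟩) / 2)) (((pinnedChain ω₂ lam β γ).gibbsMeasure N T).prod wienerPair) := by
    refine (i00.add itt).mono' (hm0.mul hmt).aestronglyMeasurable (Eventually.of_forall fun p => ?_)
    simpa [Real.norm_eq_abs] using abs_mul_le_sq_add_sq _ _
  -- the `Y`-moments in terms of the `X`- and `D`-moments
  have iXD2 : Integrable (fun p : PhaseSpace N × WienerPair => 2 * ((∫ s in (0 : ℝ)..t, (pinnedChain ω₂ lam β γ).bondCurrent N ⟨0, Nat.zero_lt_of_lt hN⟩ ((pinnedChain ω₂ lam β γ).solMap N T T s p.1 (pairPath p.2))) * (∫ s in (0 : ℝ)..t, γ * (T - (((pinnedChain ω₂ lam β γ).solMap N T T s p.1 (pairPath p.2)).2 ⟨0, Nat.zero_lt_of_lt hN⟩) ^ 2)))) (((pinnedChain ω₂ lam β γ).gibbsMeasure N T).prod wienerPair) := iXD.const_mul 2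
  have iA : Integrable (fun p : PhaseSpace N × WienerPair => (∫ s in (0 : ℝ)..t, γ * (T - (((pinnedChain ω₂ lam β γ).solMap N T T s p.1 (pairPath p.2)).2 ⟨0, Nat.zero_lt_of_lt hN⟩) ^ 2)) * (∫ s in (0 : ℝ)..t, γ * (T - (((pinnedChain ω₂ lam β γ).solMap N T T s p.1 (pairPath p.2)).2 ⟨0, Nat.zero_lt_of_lt hN⟩) ^ 2)) - 2 * ((∫ s in (0 : ℝ)..t, (pinnedChain ω₂ lam β γ).bondCurrent N ⟨0, Nat.zero_lt_of_lt hN⟩ ((pinnedChain ω₂ lam β γ).solMap N T T s p.1 (pairPath p.2))) * (∫ s in (0 : ℝ)..t, γ * (T - (((pinnedChain ω₂ lam β γ).solMap N T T s p.1 (pairPath p.2)).2 ⟨0, Nat.zero_lt_of_lt hN⟩) ^ 2)))) (((pinnedChain ω₂ lam β γ).gibbsMeasure N T).prod wienerPair) := iDD.sub iXD2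
  have lYY : ∫ p, (∫ s in (0 : ℝ)..t, (γ * (T - (((pinnedChain ω₂ lam β γ).solMap N T T s p.1 (pairPath p.2)).2 ⟨0, Nat.zero_lt_of_lt hN⟩) ^ 2) - (pinnedChain ω₂ lam β γ).bondCurrent N ⟨0, Nat.zero_lt_of_lt hN⟩ ((pinnedChain ω₂ lam β γ).solMap N T T s p.1 (pairPath p.2)))) * (∫ s in (0 : ℝ)..t, (γ * (T - (((pinnedChain ω₂ lam β γ).solMap N T T s p.1 (pairPath p.2)).2 ⟨0, Nat.zero_lt_of_lt hN⟩) ^ 2) - (pinnedChain ω₂ lam β γ).bondCurrent N ⟨0, Nat.zero_lt_of_lt hN⟩ ((pinnedChain ω₂ lam β γ).solMap N T T s p.1 (pairPath p.2)))) ∂(((pinnedChain ω₂ lam β γ).gibbsMeasure N T).prod wienerPair) = ∫ p, (∫ s in (0 : ℝ)..t, γ * (T - (((pinnedChain ω₂ lam β γ).solMap N T T s p.1 (pairPath p.2)).2 ⟨0, Nat.zero_lt_of_lt hN⟩) ^ 2)) * (∫ s in (0 : ℝ)..t, γ * (T - (((pinnedChain ω₂ lam β γ).solMap N T T s p.1 (pairPath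 p.2)).2 ⟨0, Nat.zero_lt_of_lt hN⟩) ^ 2)) ∂(((pinnedChain ω₂ lam β γ).gibbsMeasure N T).prod wienerPair) - 2 * ∫ p, (∫ s in (0 : ℝ)..t, (pinnedChain ω₂ lam β γ).bondCurrent N ⟨0, Nat.zero_lt_of_lt hN⟩ ((pinnedChain ω₂ lam β γ).solMap N T T s p.1 (pairPath p.2))) * (∫ s in (0 : ℝ)..t, γ * (T - (((pinnedChain ω₂ lam β γ).solMap N T T s p.1 (pairPath p.2)).2 ⟨0, Nat.zero_lt_of_lt hN⟩) ^ 2)) ∂(((pinnedChain ω₂ lam β γ).gibbsMeasure N T).prod wienerPair) + ∫ p, (∫ s in (0 : ℝ)..t, (pinnedChain ω₂ lam β γ).bondCurrent N ⟨0, Nat.zero_lt_of_lt hN⟩ ((pinnedChain ω₂ lam β γ).solMap N T T s p.1 (pairPath p.2))) * (∫ s in (0 : ℝ)..t, (pinnedChain ω₂ lam β γ).bondCurrent N ⟨0, Nat.zero_lt_of_lt hN⟩ ((pinnedChain ω₂ lam β γ).solMap N T T s p.1 (pairPath p.2))) ∂(((pinnedChain ω₂ lam β γ).gibbsMeasure N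 T).prod wienerPair) := by
    have h : ∀ p : PhaseSpace N × WienerPair, (∫ s in (0 : ℝ)..t, (γ * (T - (((pinnedChain ω₂ lam β γ).solMap N T T s p.1 (pairPath p.2)).2 ⟨0, Nat.zero_lt_of_lt hN⟩) ^ 2) - (pinnedChain ω₂ lam β γ).bondCurrent N ⟨0, Nat.zero_lt_of_lt hN⟩ ((pinnedChain ω₂ lam β γ).solMap N T T s p.1 (pairPath p.2)))) * (∫ s in (0 : ℝ)..t, (γ * (T - (((pinnedChain ω₂ lam β γ).solMap N T T s p.1 (pairPath p.2)).2 ⟨0, Nat.zero_lt_of_lt hN⟩) ^ 2) - (pinnedChain ω₂ lam β γ).bondCurrent N ⟨0, Nat.zero_lt_of_lt hN⟩ ((pinnedChain ω₂ lam β γ).solMap N T T s p.1 (pairPath p.2)))) =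
        (∫ s in (0 : ℝ)..t, γ * (T - (((pinnedChain ω₂ lam β γ).solMap N T T s p.1 (pairPath p.2)).2 ⟨0, Nat.zero_lt_of_lt hN⟩) ^ 2)) * (∫ s in (0 : ℝ)..t, γ * (T - (((pinnedChain ω₂ lam β γ).solMap N T T s p.1 (pairPath p.2)).2 ⟨0, Nat.zero_lt_of_lt hN⟩) ^ 2)) - 2 * ((∫ s in (0 : ℝ)..t, (pinnedChain ω₂ lam β γ).bondCurrent N ⟨0, Nat.zero_lt_of_lt hN⟩ ((pinnedChain ω₂ lam β γ).solMap N T T s p.1 (pairPath p.2))) * (∫ s in (0 : ℝ)..t, γ * (T - (((pinnedChain ω₂ lam β γ).solMap N T T s p.1 (pairPath p.2)).2 ⟨0, Nat.zero_lt_of_lt hN⟩) ^ 2))) + (∫ s in (0 : ℝ)..t, (pinnedChain ω₂ lam β γ).bondCurrent N ⟨0, Nat.zero_lt_of_lt hN⟩ ((pinnedChain ω₂ lam β γ).solMap N T T s p.1 (pairPath p.2))) * (∫ s in (0 : ℝ)..t, (pinnedChain ω₂ lam β γ).bondCurrent N ⟨0, Nat.zero_lt_of_lt hN⟩ ((pinnedChain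 ω₂ lam β γ).solMap N T T s p.1 (pairPath p.2))) := by
      intro p; rw [hYDX p]; ring
    rw [integral_congr_ae (Eventually.of_forall h), MeasureTheory.integral_add iA iXX,
      MeasureTheory.integral_sub iDD iXD2, MeasureTheory.integral_const_mul]
  have ltY : ∫ p, ((((pinnedChain ω₂ lam β γ).solMap N T T t p.1 (pairPath p.2)).2 ⟨0, Nat.zero_lt_of_lt hN⟩) ^ 2 / 2 + (pinnedChain ω₂ lam β γ).U (((pinnedChain ω₂ lam β γ).solMap N T T t p.1 (pairPath p.2)).1 ⟨0, Nat.zero_lt_of_lt hN⟩) + (pinnedChain ω₂ lam β γ).V (((pinnedChain ω₂ lam β γ).solMap N T T t p.1 (pairPath p.2)).1 ⟨1, hN⟩ - ((pinnedChain ω₂ lam β γ).solMap N T T t p.1 (pairPath p.2)).1 ⟨0, Nat.zero_lt_of_lt hN⟩) / 2) * (∫ s in (0 : ℝ)..t, (γ * (T - (((pinnedChain ω₂ lam β γ).solMap N T T s p.1 (pairPath p.2)).2 ⟨0, Nat.zero_lt_of_lt hN⟩) ^ 2) - (pinnedChain ω₂ lam β γ).bondCurrent N ⟨0, Nat.zero_lt_of_lt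 hN⟩ ((pinnedChain ω₂ lam β γ).solMap N T T s p.1 (pairPath p.2)))) ∂(((pinnedChain ω₂ lam β γ).gibbsMeasure N T).prod wienerPair) = ∫ p, ((((pinnedChain ω₂ lam β γ).solMap N T T t p.1 (pairPath p.2)).2 ⟨0, Nat.zero_lt_of_lt hN⟩) ^ 2 / 2 + (pinnedChain ω₂ lam β γ).U (((pinnedChain ω₂ lam β γ).solMap N T T t p.1 (pairPath p.2)).1 ⟨0, Nat.zero_lt_of_lt hN⟩) + (pinnedChain ω₂ lam β γ).V (((pinnedChain ω₂ lam β γ).solMap N T T t p.1 (pairPath p.2)).1 ⟨1, hN⟩ - ((pinnedChain ω₂ lam β γ).solMap N T T t p.1 (pairPath p.2)).1 ⟨0, Nat.zero_lt_of_lt hN⟩) / 2) * (∫ s in (0 : ℝ)..t, γ * (T - (((pinnedChain ω₂ lam β γ).solMap N T T s p.1 (pairPath p.2)).2 ⟨0, Nat.zero_lt_of_lt hN⟩) ^ 2)) ∂(((pinnedChain ω₂ lam β γ).gibbsMeasure N T).prod wienerPair) - ∫ p, ((((pinnedChain ω₂ lam β γ).solMap N T T t p.1 (pairPath p.2)).2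 ⟨0, Nat.zero_lt_of_lt hN⟩) ^ 2 / 2 + (pinnedChain ω₂ lam β γ).U (((pinnedChain ω₂ lam β γ).solMap N T T t p.1 (pairPath p.2)).1 ⟨0, Nat.zero_lt_of_lt hN⟩) + (pinnedChain ω₂ lam β γ).V (((pinnedChain ω₂ lam β γ).solMap N T T t p.1 (pairPath p.2)).1 ⟨1, hN⟩ - ((pinnedChain ω₂ lam β γ).solMap N T T t p.1 (pairPath p.2)).1 ⟨0, Nat.zero_lt_of_lt hN⟩) / 2) * (∫ s in (0 : ℝ)..t, (pinnedChain ω₂ lam β γ).bondCurrent N ⟨0, Nat.zero_lt_of_lt hN⟩ ((pinnedChain ω₂ lam β γ).solMap N T T s p.1 (pairPath p.2))) ∂(((pinnedChain ω₂ lam β γ).gibbsMeasure N T).prod wienerPair) := by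
    have h : ∀ p : PhaseSpace N × WienerPair, ((((pinnedChain ω₂ lam β γ).solMap N T T t p.1 (pairPath p.2)).2 ⟨0, Nat.zero_lt_of_lt hN⟩) ^ 2 / 2 + (pinnedChain ω₂ lam β γ).U (((pinnedChain ω₂ lam β γ).solMap N T T t p.1 (pairPath p.2)).1 ⟨0, Nat.zero_lt_of_lt hN⟩) + (pinnedChain ω₂ lam β γ).V (((pinnedChain ω₂ lam β γ).solMap N T T t p.1 (pairPath p.2)).1 ⟨1, hN⟩ - ((pinnedChain ω₂ lam β γ).solMap N T T t p.1 (pairPath p.2)).1 ⟨0, Nat.zero_lt_of_lt hN⟩) / 2) * (∫ s in (0 : ℝ)..t, (γ * (T - (((pinnedChain ω₂ lam β γ).solMap N T T s p.1 (pairPath p.2)).2 ⟨0, Nat.zero_lt_of_lt hN⟩) ^ 2) - (pinnedChain ω₂ lam β γ).bondCurrent N ⟨0, Nat.zero_lt_of_lt hN⟩ ((pinnedChain ω₂ lam β γ).solMap N T T s p.1 (pairPath p.2)))) = ((((pinnedChain ω₂ lam β γ).solMap N T T t p.1 (pairPath p.2)).2 ⟨0, Nat.zero_lt_of_lt hN⟩)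 ^ 2 / 2 + (pinnedChain ω₂ lam β γ).U (((pinnedChain ω₂ lam β γ).solMap N T T t p.1 (pairPath p.2)).1 ⟨0, Nat.zero_lt_of_lt hN⟩) + (pinnedChain ω₂ lam β γ).V (((pinnedChain ω₂ lam β γ).solMap N T T t p.1 (pairPath p.2)).1 ⟨1, hN⟩ - ((pinnedChain ω₂ lam β γ).solMap N T T t p.1 (pairPath p.2)).1 ⟨0, Nat.zero_lt_of_lt hN⟩) / 2) * (∫ s in (0 : ℝ)..t, γ * (T - (((pinnedChain ω₂ lam β γ).solMap N T T s p.1 (pairPath p.2)).2 ⟨0, Nat.zero_lt_of_lt hN⟩) ^ 2)) - ((((pinnedChain ω₂ lam β γ).solMap N T T t p.1 (pairPath p.2)).2 ⟨0, Nat.zero_lt_of_lt hN⟩) ^ 2 / 2 + (pinnedChain ω₂ lam β γ).U (((pinnedChain ω₂ lam β γ).solMap N T T t p.1 (pairPath p.2)).1 ⟨0, Nat.zero_lt_of_lt hN⟩) + (pinnedChain ω₂ lam β γ).V (((pinnedChain ω₂ lam β γ).solMap N T T t p.1 (pairPath p.2)).1 ⟨1, hN⟩ - ((pinnedChain ω₂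 lam β γ).solMap N T T t p.1 (pairPath p.2)).1 ⟨0, Nat.zero_lt_of_lt hN⟩) / 2) * (∫ s in (0 : ℝ)..t, (pinnedChain ω₂ lam β γ).bondCurrent N ⟨0, Nat.zero_lt_of_lt hN⟩ ((pinnedChain ω₂ lam β γ).solMap N T T s p.1 (pairPath p.2))) := by
      intro p; rw [hYDX p]; ring
    rw [integral_congr_ae (Eventually.of_forall h), MeasureTheory.integral_sub itD itX]
  have l0Y : ∫ p, ((((pinnedChain ω₂ lam β γ).solMap N T T 0 p.1 (pairPath p.2)).2 ⟨0, Nat.zero_lt_of_lt hN⟩) ^ 2 / 2 + (pinnedChain ω₂ lam β γ).U (((pinnedChain ω₂ lam β γ).solMap N T T 0 p.1 (pairPath p.2)).1 ⟨0, Nat.zero_lt_of_lt hN⟩) + (pinnedChain ω₂ lam β γ).V (((pinnedChain ω₂ lam β γ).solMap N T T 0 p.1 (pairPath p.2)).1 ⟨1, hN⟩ - ((pinnedChain ω₂ lam β γ).solMap N T T 0 p.1 (pairPath p.2)).1 ⟨0, Nat.zero_lt_of_lt hN⟩) / 2) * (∫ s in (0 : ℝ)..t, (γ * (T - (((pinnedChain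 ω₂ lam β γ).solMap N T T s p.1 (pairPath p.2)).2 ⟨0, Nat.zero_lt_of_lt hN⟩) ^ 2) - (pinnedChain ω₂ lam β γ).bondCurrent N ⟨0, Nat.zero_lt_of_lt hN⟩ ((pinnedChain ω₂ lam β γ).solMap N T T s p.1 (pairPath p.2)))) ∂(((pinnedChain ω₂ lam β γ).gibbsMeasure N T).prod wienerPair) = ∫ p, ((((pinnedChain ω₂ lam β γ).solMap N T T 0 p.1 (pairPath p.2)).2 ⟨0, Nat.zero_lt_of_lt hN⟩) ^ 2 / 2 + (pinnedChain ω₂ lam β γ).U (((pinnedChain ω₂ lam β γ).solMap N T T 0 p.1 (pairPath p.2)).1 ⟨0, Nat.zero_lt_of_lt hN⟩) + (pinnedChain ω₂ lam β γ).V (((pinnedChain ω₂ lam β γ).solMap N T T 0 p.1 (pairPath p.2)).1 ⟨1, hN⟩ - ((pinnedChain ω₂ lam β γ).solMap N T T 0 p.1 (pairPath p.2)).1 ⟨0, Nat.zero_lt_of_lt hN⟩) / 2) * (∫ s in (0 : ℝ)..t, γ * (T - (((pinnedChain ω₂ lam β γ).solMap N T T s p.1 (pairPath p.2)).2 ⟨0,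 Nat.zero_lt_of_lt hN⟩) ^ 2)) ∂(((pinnedChain ω₂ lam β γ).gibbsMeasure N T).prod wienerPair) - ∫ p, ((((pinnedChain ω₂ lam β γ).solMap N T T 0 p.1 (pairPath p.2)).2 ⟨0, Nat.zero_lt_of_lt hN⟩) ^ 2 / 2 + (pinnedChain ω₂ lam β γ).U (((pinnedChain ω₂ lam β γ).solMap N T T 0 p.1 (pairPath p.2)).1 ⟨0, Nat.zero_lt_of_lt hN⟩) + (pinnedChain ω₂ lam β γ).V (((pinnedChain ω₂ lam β γ).solMap N T T 0 p.1 (pairPath p.2)).1 ⟨1, hN⟩ - ((pinnedChain ω₂ lam β γ).solMap N T T 0 p.1 (pairPath p.2)).1 ⟨0, Nat.zero_lt_of_lt hN⟩) / 2) * (∫ s in (0 : ℝ)..t, (pinnedChain ω₂ lam β γ).bondCurrent N ⟨0, Nat.zero_lt_of_lt hN⟩ ((pinnedChain ω₂ lam β γ).solMap N T T s p.1 (pairPath p.2))) ∂(((pinnedChain ω₂ lam β γ).gibbsMeasure N T).prod wienerPair) := by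
    have h : ∀ p : PhaseSpace N × WienerPair, ((((pinnedChain ω₂ lam β γ).solMap N T T 0 p.1 (pairPath p.2)).2 ⟨0, Nat.zero_lt_of_lt hN⟩) ^ 2 / 2 + (pinnedChain ω₂ lam β γ).U (((pinnedChain ω₂ lam β γ).solMap N T T 0 p.1 (pairPath p.2)).1 ⟨0, Nat.zero_lt_of_lt hN⟩) + (pinnedChain ω₂ lam β γ).V (((pinnedChain ω₂ lam β γ).solMap N T T 0 p.1 (pairPath p.2)).1 ⟨1, hN⟩ - ((pinnedChain ω₂ lam β γ).solMap N T T 0 p.1 (pairPath p.2)).1 ⟨0, Nat.zero_lt_of_lt hN⟩) / 2) * (∫ s in (0 : ℝ)..t, (γ * (T - (((pinnedChain ω₂ lam β γ).solMap N T T s p.1 (pairPath p.2)).2 ⟨0, Nat.zero_lt_of_lt hN⟩) ^ 2) - (pinnedChain ω₂ lam β γ).bondCurrent N ⟨0, Nat.zero_lt_of_lt hN⟩ ((pinnedChain ω₂ lam β γ).solMap N T T s p.1 (pairPath p.2)))) = ((((pinnedChain ω₂ lam β γ).solMap N T T 0 p.1 (pairPath p.2)).2 ⟨0, Nat.zero_lt_of_lt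 hN⟩) ^ 2 / 2 + (pinnedChain ω₂ lam β γ).U (((pinnedChain ω₂ lam β γ).solMap N T T 0 p.1 (pairPath p.2)).1 ⟨0, Nat.zero_lt_of_lt hN⟩) + (pinnedChain ω₂ lam β γ).V (((pinnedChain ω₂ lam β γ).solMap N T T 0 p.1 (pairPath p.2)).1 ⟨1, hN⟩ - ((pinnedChain ω₂ lam β γ).solMap N T T 0 p.1 (pairPath p.2)).1 ⟨0, Nat.zero_lt_of_lt hN⟩) / 2) * (∫ s in (0 : ℝ)..t, γ * (T - (((pinnedChain ω₂ lam β γ).solMap N T T s p.1 (pairPath p.2)).2 ⟨0, Nat.zero_lt_of_lt hN⟩) ^ 2)) - ((((pinnedChain ω₂ lam β γ).solMap N T T 0 p.1 (pairPath p.2)).2 ⟨0, Nat.zero_lt_of_lt hN⟩) ^ 2 / 2 + (pinnedChain ω₂ lam β γ).U (((pinnedChain ω₂ lam β γ).solMap N T T 0 p.1 (pairPath p.2)).1 ⟨0, Nat.zero_lt_of_lt hN⟩) + (pinnedChain ω₂ lam β γ).V (((pinnedChain ω₂ lam β γ).solMap N T T 0 p.1 (pairPath p.2)).1 ⟨1,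 hN⟩ - ((pinnedChain ω₂ lam β γ).solMap N T T 0 p.1 (pairPath p.2)).1 ⟨0, Nat.zero_lt_of_lt hN⟩) / 2) * (∫ s in (0 : ℝ)..t, (pinnedChain ω₂ lam β γ).bondCurrent N ⟨0, Nat.zero_lt_of_lt hN⟩ ((pinnedChain ω₂ lam β γ).solMap N T T s p.1 (pairPath p.2))) := by
      intro p; rw [hYDX p]; ring
    rw [integral_congr_ae (Eventually.of_forall h), MeasureTheory.integral_sub i0D i0X]
  -- positivity: `0 ≤ E[(X + 2e(z_t) - 2e(z_0))²]` and `0 ≤ E[(e(z_t) + e(z_0))²]`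
  have hsqt : ∫ p, ((((pinnedChain ω₂ lam β γ).solMap N T T t p.1 (pairPath p.2)).2 ⟨0, Nat.zero_lt_of_lt hN⟩) ^ 2 / 2 + (pinnedChain ω₂ lam β γ).U (((pinnedChain ω₂ lam β γ).solMap N T T t p.1 (pairPath p.2)).1 ⟨0, Nat.zero_lt_of_lt hN⟩) + (pinnedChain ω₂ lam β γ).V (((pinnedChain ω₂ lam β γ).solMap N T T t p.1 (pairPath p.2)).1 ⟨1, hN⟩ - ((pinnedChain ω₂ lam β γ).solMap N T T t p.1 (pairPath p.2)).1 ⟨0, Nat.zero_lt_of_lt hN⟩) / 2) ^ 2 ∂(((pinnedChain ω₂ lam β γ).gibbsMeasure N T).prod wienerPair) = ∫ p, ((((pinnedChain ω₂ lam β γ).solMap N T T t p.1 (pairPath p.2)).2 ⟨0, Nat.zero_lt_of_lt hN⟩) ^ 2 / 2 + (pinnedChain ω₂ lam β γ).U (((pinnedChain ω₂ lam β γ).solMap N T T t p.1 (pairPath p.2)).1 ⟨0, Nat.zero_lt_of_lt hN⟩) + (pinnedChain ω₂ lam β γ).V (((pinnedChain ω₂ lam β γ).solMap N T T t p.1 (pairPath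 p.2)).1 ⟨1, hN⟩ - ((pinnedChain ω₂ lam β γ).solMap N T T t p.1 (pairPath p.2)).1 ⟨0, Nat.zero_lt_of_lt hN⟩) / 2) * ((((pinnedChain ω₂ lam β γ).solMap N T T t p.1 (pairPath p.2)).2 ⟨0, Nat.zero_lt_of_lt hN⟩) ^ 2 / 2 + (pinnedChain ω₂ lam β γ).U (((pinnedChain ω₂ lam β γ).solMap N T T t p.1 (pairPath p.2)).1 ⟨0, Nat.zero_lt_of_lt hN⟩) + (pinnedChain ω₂ lam β γ).V (((pinnedChain ω₂ lam β γ).solMap N T T t p.1 (pairPath p.2)).1 ⟨1, hN⟩ - ((pinnedChain ω₂ lam β γ).solMap N T T t p.1 (pairPath p.2)).1 ⟨0, Nat.zero_lt_of_lt hN⟩) / 2) ∂(((pinnedChain ω₂ lam β γ).gibbsMeasure N T).prod wienerPair) :=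
    integral_congr_ae (Eventually.of_forall fun p => sq _)
  have hsq0 : ∫ p, ((((pinnedChain ω₂ lam β γ).solMap N T T 0 p.1 (pairPath p.2)).2 ⟨0, Nat.zero_lt_of_lt hN⟩) ^ 2 / 2 + (pinnedChain ω₂ lam β γ).U (((pinnedChain ω₂ lam β γ).solMap N T T 0 p.1 (pairPath p.2)).1 ⟨0, Nat.zero_lt_of_lt hN⟩) + (pinnedChain ω₂ lam β γ).V (((pinnedChain ω₂ lam β γ).solMap N T T 0 p.1 (pairPath p.2)).1 ⟨1, hN⟩ - ((pinnedChain ω₂ lam β γ).solMap N T T 0 p.1 (pairPath p.2)).1 ⟨0, Nat.zero_lt_of_lt hN⟩) / 2) ^ 2 ∂(((pinnedChain ω₂ lam β γ).gibbsMeasure N T).prod wienerPair) = ∫ p, ((((pinnedChain ω₂ lam β γ).solMap N T T 0 p.1 (pairPath p.2)).2 ⟨0, Nat.zero_lt_of_lt hN⟩) ^ 2 / 2 + (pinnedChain ω₂ lam β γ).U (((pinnedChain ω₂ lam β γ).solMap N T T 0 p.1 (pairPath p.2)).1 ⟨0, Nat.zero_lt_of_lt hN⟩) + (pinnedChain ω₂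 lam β γ).V (((pinnedChain ω₂ lam β γ).solMap N T T 0 p.1 (pairPath p.2)).1 ⟨1, hN⟩ - ((pinnedChain ω₂ lam β γ).solMap N T T 0 p.1 (pairPath p.2)).1 ⟨0, Nat.zero_lt_of_lt hN⟩) / 2) * ((((pinnedChain ω₂ lam β γ).solMap N T T 0 p.1 (pairPath p.2)).2 ⟨0, Nat.zero_lt_of_lt hN⟩) ^ 2 / 2 + (pinnedChain ω₂ lam β γ).U (((pinnedChain ω₂ lam β γ).solMap N T T 0 p.1 (pairPath p.2)).1 ⟨0, Nat.zero_lt_of_lt hN⟩) + (pinnedChain ω₂ lam β γ).V (((pinnedChain ω₂ lam β γ).solMap N T T 0 p.1 (pairPath p.2)).1 ⟨1, hN⟩ - ((pinnedChain ω₂ lam β γ).solMap N T T 0 p.1 (pairPath p.2)).1 ⟨0, Nat.zero_lt_of_lt hN⟩) / 2) ∂(((pinnedChain ω₂ lam β γ).gibbsMeasure N T).prod wienerPair) :=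
    integral_congr_ae (Eventually.of_forall fun p => sq _)
  have itt' : Integrable (fun p : PhaseSpace N × WienerPair => ((((pinnedChain ω₂ lam β γ).solMap N T T t p.1 (pairPath p.2)).2 ⟨0, Nat.zero_lt_of_lt hN⟩) ^ 2 / 2 + (pinnedChain ω₂ lam β γ).U (((pinnedChain ω₂ lam β γ).solMap N T T t p.1 (pairPath p.2)).1 ⟨0, Nat.zero_lt_of_lt hN⟩) + (pinnedChain ω₂ lam β γ).V (((pinnedChain ω₂ lam β γ).solMap N T T t p.1 (pairPath p.2)).1 ⟨1, hN⟩ - ((pinnedChain ω₂ lam β γ).solMap N T T t p.1 (pairPath p.2)).1 ⟨0, Nat.zero_lt_of_lt hN⟩) / 2) * ((((pinnedChain ω₂ lam β γ).solMap N T T t p.1 (pairPath p.2)).2 ⟨0, Nat.zero_lt_of_lt hN⟩) ^ 2 / 2 + (pinnedChain ω₂ lam β γ).U (((pinnedChain ω₂ lam β γ).solMap N T T t p.1 (pairPath p.2)).1 ⟨0, Nat.zero_lt_of_lt hN⟩) + (pinnedChain ω₂ lam β γ).V (((pinnedChain ω₂ lam β γ).solMap N T T t p.1 (pairPath p.2)).1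 ⟨1, hN⟩ - ((pinnedChain ω₂ lam β γ).solMap N T T t p.1 (pairPath p.2)).1 ⟨0, Nat.zero_lt_of_lt hN⟩) / 2)) (((pinnedChain ω₂ lam β γ).gibbsMeasure N T).prod wienerPair) :=
    itt.congr (Eventually.of_forall fun p => sq _)
  have i00' : Integrable (fun p : PhaseSpace N × WienerPair => ((((pinnedChain ω₂ lam β γ).solMap N T T 0 p.1 (pairPath p.2)).2 ⟨0, Nat.zero_lt_of_lt hN⟩) ^ 2 / 2 + (pinnedChain ω₂ lam β γ).U (((pinnedChain ω₂ lam β γ).solMap N T T 0 p.1 (pairPath p.2)).1 ⟨0, Nat.zero_lt_of_lt hN⟩) + (pinnedChain ω₂ lam β γ).V (((pinnedChain ω₂ lam β γ).solMap N T T 0 p.1 (pairPath p.2)).1 ⟨1, hN⟩ - ((pinnedChain ω₂ lam β γ).solMap N T T 0 p.1 (pairPath p.2)).1 ⟨0, Nat.zero_lt_of_lt hN⟩) / 2) * ((((pinnedChain ω₂ lam β γ).solMap N T T 0 p.1 (pairPath p.2)).2 ⟨0, Nat.zero_lt_of_lt hN⟩) ^ 2 / 2 + (pinnedChain ω₂ lam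 β γ).U (((pinnedChain ω₂ lam β γ).solMap N T T 0 p.1 (pairPath p.2)).1 ⟨0, Nat.zero_lt_of_lt hN⟩) + (pinnedChain ω₂ lam β γ).V (((pinnedChain ω₂ lam β γ).solMap N T T 0 p.1 (pairPath p.2)).1 ⟨1, hN⟩ - ((pinnedChain ω₂ lam β γ).solMap N T T 0 p.1 (pairPath p.2)).1 ⟨0, Nat.zero_lt_of_lt hN⟩) / 2)) (((pinnedChain ω₂ lam β γ).gibbsMeasure N T).prod wienerPair) :=
    i00.congr (Eventually.of_forall fun p => sq _)
  have j2 : Integrable (fun p : PhaseSpace N × WienerPair => 4 * (((((pinnedChain ω₂ lam β γ).solMap N T T t p.1 (pairPath p.2)).2 ⟨0, Nat.zero_lt_of_lt hN⟩) ^ 2 / 2 + (pinnedChain ω₂ lam β γ).U (((pinnedChain ω₂ lam β γ).solMap N T T t p.1 (pairPath p.2)).1 ⟨0, Nat.zero_lt_of_lt hN⟩) + (pinnedChain ω₂ lam β γ).V (((pinnedChain ω₂ lam β γ).solMap N T T t p.1 (pairPath p.2)).1 ⟨1, hN⟩ - ((pinnedChain ω₂ lam β γ).solMap N T T t p.1 (pairPath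 p.2)).1 ⟨0, Nat.zero_lt_of_lt hN⟩) / 2) * ((((pinnedChain ω₂ lam β γ).solMap N T T t p.1 (pairPath p.2)).2 ⟨0, Nat.zero_lt_of_lt hN⟩) ^ 2 / 2 + (pinnedChain ω₂ lam β γ).U (((pinnedChain ω₂ lam β γ).solMap N T T t p.1 (pairPath p.2)).1 ⟨0, Nat.zero_lt_of_lt hN⟩) + (pinnedChain ω₂ lam β γ).V (((pinnedChain ω₂ lam β γ).solMap N T T t p.1 (pairPath p.2)).1 ⟨1, hN⟩ - ((pinnedChain ω₂ lam β γ).solMap N T T t p.1 (pairPath p.2)).1 ⟨0, Nat.zero_lt_of_lt hN⟩) / 2))) (((pinnedChain ω₂ lam β γ).gibbsMeasure N T).prod wienerPair) := itt'.const_mul 4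
  have j3 : Integrable (fun p : PhaseSpace N × WienerPair => 4 * (((((pinnedChain ω₂ lam β γ).solMap N T T 0 p.1 (pairPath p.2)).2 ⟨0, Nat.zero_lt_of_lt hN⟩) ^ 2 / 2 + (pinnedChain ω₂ lam β γ).U (((pinnedChain ω₂ lam β γ).solMap N T T 0 p.1 (pairPath p.2)).1 ⟨0, Nat.zero_lt_of_lt hN⟩) + (pinnedChain ω₂ lam β γ).V (((pinnedChain ω₂ lam β γ).solMap N T T 0 p.1 (pairPath p.2)).1 ⟨1, hN⟩ - ((pinnedChain ω₂ lam β γ).solMap N T T 0 p.1 (pairPath p.2)).1 ⟨0, Nat.zero_lt_of_lt hN⟩) / 2) * ((((pinnedChain ω₂ lam β γ).solMap N T T 0 p.1 (pairPath p.2)).2 ⟨0, Nat.zero_lt_of_lt hN⟩) ^ 2 / 2 + (pinnedChain ω₂ lam β γ).U (((pinnedChain ω₂ lam β γ).solMap N T T 0 p.1 (pairPath p.2)).1 ⟨0, Nat.zero_lt_of_lt hN⟩) + (pinnedChain ω₂ lam β γ).V (((pinnedChain ω₂ lam β γ).solMap N T T 0 p.1 (pairPath p.2)).1 ⟨1, hN⟩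 - ((pinnedChain ω₂ lam β γ).solMap N T T 0 p.1 (pairPath p.2)).1 ⟨0, Nat.zero_lt_of_lt hN⟩) / 2))) (((pinnedChain ω₂ lam β γ).gibbsMeasure N T).prod wienerPair) := i00'.const_mul 4
  have j4 : Integrable (fun p : PhaseSpace N × WienerPair => 4 * (((((pinnedChain ω₂ lam β γ).solMap N T T t p.1 (pairPath p.2)).2 ⟨0, Nat.zero_lt_of_lt hN⟩) ^ 2 / 2 + (pinnedChain ω₂ lam β γ).U (((pinnedChain ω₂ lam β γ).solMap N T T t p.1 (pairPath p.2)).1 ⟨0, Nat.zero_lt_of_lt hN⟩) + (pinnedChain ω₂ lam β γ).V (((pinnedChain ω₂ lam β γ).solMap N T T t p.1 (pairPath p.2)).1 ⟨1, hN⟩ - ((pinnedChain ω₂ lam β γ).solMap N T T t p.1 (pairPath p.2)).1 ⟨0, Nat.zero_lt_of_lt hN⟩) / 2) * (∫ s in (0 : ℝ)..t, (pinnedChain ω₂ lam β γ).bondCurrent N ⟨0, Nat.zero_lt_of_lt hN⟩ ((pinnedChain ω₂ lam β γ).solMap N T T s p.1 (pairPath p.2))))) (((pinnedChain ω₂ lam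 β γ).gibbsMeasure N T).prod wienerPair) := itX.const_mul 4
  have j5 : Integrable (fun p : PhaseSpace N × WienerPair => 4 * (((((pinnedChain ω₂ lam β γ).solMap N T T 0 p.1 (pairPath p.2)).2 ⟨0, Nat.zero_lt_of_lt hN⟩) ^ 2 / 2 + (pinnedChain ω₂ lam β γ).U (((pinnedChain ω₂ lam β γ).solMap N T T 0 p.1 (pairPath p.2)).1 ⟨0, Nat.zero_lt_of_lt hN⟩) + (pinnedChain ω₂ lam β γ).V (((pinnedChain ω₂ lam β γ).solMap N T T 0 p.1 (pairPath p.2)).1 ⟨1, hN⟩ - ((pinnedChain ω₂ lam β γ).solMap N T T 0 p.1 (pairPath p.2)).1 ⟨0, Nat.zero_lt_of_lt hN⟩) / 2) * (∫ s in (0 : ℝ)..t, (pinnedChain ω₂ lam β γ).bondCurrent N ⟨0, Nat.zero_lt_of_lt hN⟩ ((pinnedChain ω₂ lam β γ).solMap N T T s p.1 (pairPath p.2))))) (((pinnedChain ω₂ lam β γ).gibbsMeasure N T).prod wienerPair) := i0X.const_mul 4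
  have j6 : Integrable (fun p : PhaseSpace N × WienerPair => 8 * (((((pinnedChain ω₂ lam β γ).solMap N T T 0 p.1 (pairPath p.2)).2 ⟨0, Nat.zero_lt_of_lt hN⟩) ^ 2 / 2 + (pinnedChain ω₂ lam β γ).U (((pinnedChain ω₂ lam β γ).solMap N T T 0 p.1 (pairPath p.2)).1 ⟨0, Nat.zero_lt_of_lt hN⟩) + (pinnedChain ω₂ lam β γ).V (((pinnedChain ω₂ lam β γ).solMap N T T 0 p.1 (pairPath p.2)).1 ⟨1, hN⟩ - ((pinnedChain ω₂ lam β γ).solMap N T T 0 p.1 (pairPath p.2)).1 ⟨0, Nat.zero_lt_of_lt hN⟩) / 2) * ((((pinnedChain ω₂ lam β γ).solMap N T T t p.1 (pairPath p.2)).2 ⟨0, Nat.zero_lt_of_lt hN⟩) ^ 2 / 2 + (pinnedChain ω₂ lam β γ).U (((pinnedChain ω₂ lam β γ).solMap N T T t p.1 (pairPath p.2)).1 ⟨0, Nat.zero_lt_of_lt hN⟩) + (pinnedChain ω₂ lam β γ).V (((pinnedChain ω₂ lam β γ).solMap N T T t p.1 (pairPath p.2)).1 ⟨1, hN⟩ -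 ((pinnedChain ω₂ lam β γ).solMap N T T t p.1 (pairPath p.2)).1 ⟨0, Nat.zero_lt_of_lt hN⟩) / 2))) (((pinnedChain ω₂ lam β γ).gibbsMeasure N T).prod wienerPair) := i0t.const_mul 8
  have s2 : Integrable (fun p : PhaseSpace N × WienerPair => (∫ s in (0 : ℝ)..t, (pinnedChain ω₂ lam β γ).bondCurrent N ⟨0, Nat.zero_lt_of_lt hN⟩ ((pinnedChain ω₂ lam β γ).solMap N T T s p.1 (pairPath p.2))) * (∫ s in (0 : ℝ)..t, (pinnedChain ω₂ lam β γ).bondCurrent N ⟨0, Nat.zero_lt_of_lt hN⟩ ((pinnedChain ω₂ lam β γ).solMap N T T s p.1 (pairPath p.2))) + 4 * (((((pinnedChain ω₂ lam β γ).solMap N T T t p.1 (pairPath p.2)).2 ⟨0, Nat.zero_lt_of_lt hN⟩) ^ 2 / 2 + (pinnedChain ω₂ lam β γ).U (((pinnedChain ω₂ lam β γ).solMap N T T t p.1 (pairPath p.2)).1 ⟨0, Nat.zero_lt_of_lt hN⟩) + (pinnedChain ω₂ lam β γ).V (((pinnedChain ω₂ lam β γ).solMap N T T t p.1 (pairPath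 p.2)).1 ⟨1, hN⟩ - ((pinnedChain ω₂ lam β γ).solMap N T T t p.1 (pairPath p.2)).1 ⟨0, Nat.zero_lt_of_lt hN⟩) / 2) * ((((pinnedChain ω₂ lam β γ).solMap N T T t p.1 (pairPath p.2)).2 ⟨0, Nat.zero_lt_of_lt hN⟩) ^ 2 / 2 + (pinnedChain ω₂ lam β γ).U (((pinnedChain ω₂ lam β γ).solMap N T T t p.1 (pairPath p.2)).1 ⟨0, Nat.zero_lt_of_lt hN⟩) + (pinnedChain ω₂ lam β γ).V (((pinnedChain ω₂ lam β γ).solMap N T T t p.1 (pairPath p.2)).1 ⟨1, hN⟩ - ((pinnedChain ω₂ lam β γ).solMap N T T t p.1 (pairPath p.2)).1 ⟨0, Nat.zero_lt_of_lt hN⟩) / 2))) (((pinnedChain ω₂ lam β γ).gibbsMeasure N T).prod wienerPair) := iXX.add j2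
  have s3 : Integrable (fun p : PhaseSpace N × WienerPair =>
      (∫ s in (0 : ℝ)..t, (pinnedChain ω₂ lam β γ).bondCurrent N ⟨0, Nat.zero_lt_of_lt hN⟩ ((pinnedChain ω₂ lam β γ).solMap N T T s p.1 (pairPath p.2))) * (∫ s in (0 : ℝ)..t, (pinnedChain ω₂ lam β γ).bondCurrent N ⟨0, Nat.zero_lt_of_lt hN⟩ ((pinnedChain ω₂ lam β γ).solMap N T T s p.1 (pairPath p.2))) + 4 * (((((pinnedChain ω₂ lam β γ).solMap N T T t p.1 (pairPath p.2)).2 ⟨0, Nat.zero_lt_of_lt hN⟩) ^ 2 / 2 + (pinnedChain ω₂ lam β γ).U (((pinnedChain ω₂ lam β γ).solMap N T T t p.1 (pairPath p.2)).1 ⟨0, Nat.zero_lt_of_lt hN⟩) + (pinnedChain ω₂ lam β γ).V (((pinnedChain ω₂ lam β γ).solMap N T T t p.1 (pairPath p.2)).1 ⟨1, hN⟩ - ((pinnedChain ω₂ lam β γ).solMap N T T t p.1 (pairPath p.2)).1 ⟨0, Nat.zero_lt_of_lt hN⟩) / 2) * ((((pinnedChain ω₂ lam β γ).solMap N T T t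 p.1 (pairPath p.2)).2 ⟨0, Nat.zero_lt_of_lt hN⟩) ^ 2 / 2 + (pinnedChain ω₂ lam β γ).U (((pinnedChain ω₂ lam β γ).solMap N T T t p.1 (pairPath p.2)).1 ⟨0, Nat.zero_lt_of_lt hN⟩) + (pinnedChain ω₂ lam β γ).V (((pinnedChain ω₂ lam β γ).solMap N T T t p.1 (pairPath p.2)).1 ⟨1, hN⟩ - ((pinnedChain ω₂ lam β γ).solMap N T T t p.1 (pairPath p.2)).1 ⟨0, Nat.zero_lt_of_lt hN⟩) / 2)) + 4 * (((((pinnedChain ω₂ lam β γ).solMap N T T 0 p.1 (pairPath p.2)).2 ⟨0, Nat.zero_lt_of_lt hN⟩) ^ 2 / 2 + (pinnedChain ω₂ lam β γ).U (((pinnedChain ω₂ lam β γ).solMap N T T 0 p.1 (pairPath p.2)).1 ⟨0, Nat.zero_lt_of_lt hN⟩) + (pinnedChain ω₂ lam β γ).V (((pinnedChain ω₂ lam β γ).solMap N T T 0 p.1 (pairPath p.2)).1 ⟨1, hN⟩ - ((pinnedChain ω₂ lam β γ).solMap N T T 0 p.1 (pairPath p.2)).1 ⟨0, Nat.zero_lt_of_lt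 hN⟩) / 2) * ((((pinnedChain ω₂ lam β γ).solMap N T T 0 p.1 (pairPath p.2)).2 ⟨0, Nat.zero_lt_of_lt hN⟩) ^ 2 / 2 + (pinnedChain ω₂ lam β γ).U (((pinnedChain ω₂ lam β γ).solMap N T T 0 p.1 (pairPath p.2)).1 ⟨0, Nat.zero_lt_of_lt hN⟩) + (pinnedChain ω₂ lam β γ).V (((pinnedChain ω₂ lam β γ).solMap N T T 0 p.1 (pairPath p.2)).1 ⟨1, hN⟩ - ((pinnedChain ω₂ lam β γ).solMap N T T 0 p.1 (pairPath p.2)).1 ⟨0, Nat.zero_lt_of_lt hN⟩) / 2))) (((pinnedChain ω₂ lam β γ).gibbsMeasure N T).prod wienerPair) := s2.add j3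
  have s4 : Integrable (fun p : PhaseSpace N × WienerPair =>
      (∫ s in (0 : ℝ)..t, (pinnedChain ω₂ lam β γ).bondCurrent N ⟨0, Nat.zero_lt_of_lt hN⟩ ((pinnedChain ω₂ lam β γ).solMap N T T s p.1 (pairPath p.2))) * (∫ s in (0 : ℝ)..t, (pinnedChain ω₂ lam β γ).bondCurrent N ⟨0, Nat.zero_lt_of_lt hN⟩ ((pinnedChain ω₂ lam β γ).solMap N T T s p.1 (pairPath p.2))) + 4 * (((((pinnedChain ω₂ lam β γ).solMap N T T t p.1 (pairPath p.2)).2 ⟨0, Nat.zero_lt_of_lt hN⟩) ^ 2 / 2 + (pinnedChain ω₂ lam β γ).U (((pinnedChain ω₂ lam β γ).solMap N T T t p.1 (pairPath p.2)).1 ⟨0, Nat.zero_lt_of_lt hN⟩) + (pinnedChain ω₂ lam β γ).V (((pinnedChain ω₂ lam β γ).solMap N T T t p.1 (pairPath p.2)).1 ⟨1, hN⟩ - ((pinnedChain ω₂ lam β γ).solMap N T T t p.1 (pairPath p.2)).1 ⟨0, Nat.zero_lt_of_lt hN⟩) / 2) * ((((pinnedChain ω₂ lam β γ).solMap N T T t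 p.1 (pairPath p.2)).2 ⟨0, Nat.zero_lt_of_lt hN⟩) ^ 2 / 2 + (pinnedChain ω₂ lam β γ).U (((pinnedChain ω₂ lam β γ).solMap N T T t p.1 (pairPath p.2)).1 ⟨0, Nat.zero_lt_of_lt hN⟩) + (pinnedChain ω₂ lam β γ).V (((pinnedChain ω₂ lam β γ).solMap N T T t p.1 (pairPath p.2)).1 ⟨1, hN⟩ - ((pinnedChain ω₂ lam β γ).solMap N T T t p.1 (pairPath p.2)).1 ⟨0, Nat.zero_lt_of_lt hN⟩) / 2)) + 4 * (((((pinnedChain ω₂ lam β γ).solMap N T T 0 p.1 (pairPath p.2)).2 ⟨0, Nat.zero_lt_of_lt hN⟩) ^ 2 / 2 + (pinnedChain ω₂ lam β γ).U (((pinnedChain ω₂ lam β γ).solMap N T T 0 p.1 (pairPath p.2)).1 ⟨0, Nat.zero_lt_of_lt hN⟩) + (pinnedChain ω₂ lam β γ).V (((pinnedChain ω₂ lam β γ).solMap N T T 0 p.1 (pairPath p.2)).1 ⟨1, hN⟩ - ((pinnedChain ω₂ lam β γ).solMap N T T 0 p.1 (pairPath p.2)).1 ⟨0, Nat.zero_lt_of_lt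 hN⟩) / 2) * ((((pinnedChain ω₂ lam β γ).solMap N T T 0 p.1 (pairPath p.2)).2 ⟨0, Nat.zero_lt_of_lt hN⟩) ^ 2 / 2 + (pinnedChain ω₂ lam β γ).U (((pinnedChain ω₂ lam β γ).solMap N T T 0 p.1 (pairPath p.2)).1 ⟨0, Nat.zero_lt_of_lt hN⟩) + (pinnedChain ω₂ lam β γ).V (((pinnedChain ω₂ lam β γ).solMap N T T 0 p.1 (pairPath p.2)).1 ⟨1, hN⟩ - ((pinnedChain ω₂ lam β γ).solMap N T T 0 p.1 (pairPath p.2)).1 ⟨0, Nat.zero_lt_of_lt hN⟩) / 2)) + 4 * (((((pinnedChain ω₂ lam β γ).solMap N T T t p.1 (pairPath p.2)).2 ⟨0, Nat.zero_lt_of_lt hN⟩) ^ 2 / 2 + (pinnedChain ω₂ lam β γ).U (((pinnedChain ω₂ lam β γ).solMap N T T t p.1 (pairPath p.2)).1 ⟨0, Nat.zero_lt_of_lt hN⟩) + (pinnedChain ω₂ lam β γ).V (((pinnedChain ω₂ lam β γ).solMap N T T t p.1 (pairPath p.2)).1 ⟨1, hN⟩ - ((pinnedChain ω₂ lam β γ).solMap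 N T T t p.1 (pairPath p.2)).1 ⟨0, Nat.zero_lt_of_lt hN⟩) / 2) * (∫ s in (0 : ℝ)..t, (pinnedChain ω₂ lam β γ).bondCurrent N ⟨0, Nat.zero_lt_of_lt hN⟩ ((pinnedChain ω₂ lam β γ).solMap N T T s p.1 (pairPath p.2))))) (((pinnedChain ω₂ lam β γ).gibbsMeasure N T).prod wienerPair) := s3.add j4
  have s5 : Integrable (fun p : PhaseSpace N × WienerPair =>
      (∫ s in (0 : ℝ)..t, (pinnedChain ω₂ lam β γ).bondCurrent N ⟨0, Nat.zero_lt_of_lt hN⟩ ((pinnedChain ω₂ lam β γ).solMap N T T s p.1 (pairPath p.2))) * (∫ s in (0 : ℝ)..t, (pinnedChain ω₂ lam β γ).bondCurrent N ⟨0, Nat.zero_lt_of_lt hN⟩ ((pinnedChain ω₂ lam β γ).solMap N T T s p.1 (pairPath p.2))) + 4 * (((((pinnedChain ω₂ lam β γ).solMap N T T t p.1 (pairPath p.2)).2 ⟨0, Nat.zero_lt_of_lt hN⟩) ^ 2 / 2 + (pinnedChain ω₂ lam β γ).U (((pinnedChain ω₂ lam β γ).solMap N T T t p.1 (pairPath p.2)).1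 ⟨0, Nat.zero_lt_of_lt hN⟩) + (pinnedChain ω₂ lam β γ).V (((pinnedChain ω₂ lam β γ).solMap N T T t p.1 (pairPath p.2)).1 ⟨1, hN⟩ - ((pinnedChain ω₂ lam β γ).solMap N T T t p.1 (pairPath p.2)).1 ⟨0, Nat.zero_lt_of_lt hN⟩) / 2) * ((((pinnedChain ω₂ lam β γ).solMap N T T t p.1 (pairPath p.2)).2 ⟨0, Nat.zero_lt_of_lt hN⟩) ^ 2 / 2 + (pinnedChain ω₂ lam β γ).U (((pinnedChain ω₂ lam β γ).solMap N T T t p.1 (pairPath p.2)).1 ⟨0, Nat.zero_lt_of_lt hN⟩) + (pinnedChain ω₂ lam β γ).V (((pinnedChain ω₂ lam β γ).solMap N T T t p.1 (pairPath p.2)).1 ⟨1, hN⟩ - ((pinnedChain ω₂ lam β γ).solMap N T T t p.1 (pairPath p.2)).1 ⟨0, Nat.zero_lt_of_lt hN⟩) / 2)) + 4 * (((((pinnedChain ω₂ lam β γ).solMap N T T 0 p.1 (pairPath p.2)).2 ⟨0, Nat.zero_lt_of_lt hN⟩) ^ 2 / 2 + (pinnedChain ω₂ lam β γ).U (((pinnedChain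 ω₂ lam β γ).solMap N T T 0 p.1 (pairPath p.2)).1 ⟨0, Nat.zero_lt_of_lt hN⟩) + (pinnedChain ω₂ lam β γ).V (((pinnedChain ω₂ lam β γ).solMap N T T 0 p.1 (pairPath p.2)).1 ⟨1, hN⟩ - ((pinnedChain ω₂ lam β γ).solMap N T T 0 p.1 (pairPath p.2)).1 ⟨0, Nat.zero_lt_of_lt hN⟩) / 2) * ((((pinnedChain ω₂ lam β γ).solMap N T T 0 p.1 (pairPath p.2)).2 ⟨0, Nat.zero_lt_of_lt hN⟩) ^ 2 / 2 + (pinnedChain ω₂ lam β γ).U (((pinnedChain ω₂ lam β γ).solMap N T T 0 p.1 (pairPath p.2)).1 ⟨0, Nat.zero_lt_of_lt hN⟩) + (pinnedChain ω₂ lam β γ).V (((pinnedChain ω₂ lam β γ).solMap N T T 0 p.1 (pairPath p.2)).1 ⟨1, hN⟩ - ((pinnedChain ω₂ lam β γ).solMap N T T 0 p.1 (pairPath p.2)).1 ⟨0, Nat.zero_lt_of_lt hN⟩) / 2)) + 4 * (((((pinnedChain ω₂ lam β γ).solMap N T T t p.1 (pairPath p.2)).2 ⟨0, Nat.zero_lt_of_lt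 hN⟩) ^ 2 / 2 + (pinnedChain ω₂ lam β γ).U (((pinnedChain ω₂ lam β γ).solMap N T T t p.1 (pairPath p.2)).1 ⟨0, Nat.zero_lt_of_lt hN⟩) + (pinnedChain ω₂ lam β γ).V (((pinnedChain ω₂ lam β γ).solMap N T T t p.1 (pairPath p.2)).1 ⟨1, hN⟩ - ((pinnedChain ω₂ lam β γ).solMap N T T t p.1 (pairPath p.2)).1 ⟨0, Nat.zero_lt_of_lt hN⟩) / 2) * (∫ s in (0 : ℝ)..t, (pinnedChain ω₂ lam β γ).bondCurrent N ⟨0, Nat.zero_lt_of_lt hN⟩ ((pinnedChain ω₂ lam β γ).solMap N T T s p.1 (pairPath p.2)))) -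
        4 * (((((pinnedChain ω₂ lam β γ).solMap N T T 0 p.1 (pairPath p.2)).2 ⟨0, Nat.zero_lt_of_lt hN⟩) ^ 2 / 2 + (pinnedChain ω₂ lam β γ).U (((pinnedChain ω₂ lam β γ).solMap N T T 0 p.1 (pairPath p.2)).1 ⟨0, Nat.zero_lt_of_lt hN⟩) + (pinnedChain ω₂ lam β γ).V (((pinnedChain ω₂ lam β γ).solMap N T T 0 p.1 (pairPath p.2)).1 ⟨1, hN⟩ - ((pinnedChain ω₂ lam β γ).solMap N T T 0 p.1 (pairPath p.2)).1 ⟨0, Nat.zero_lt_of_lt hN⟩) / 2) * (∫ s in (0 : ℝ)..t, (pinnedChain ω₂ lam β γ).bondCurrent N ⟨0, Nat.zero_lt_of_lt hN⟩ ((pinnedChain ω₂ lam β γ).solMap N T T s p.1 (pairPath p.2))))) (((pinnedChain ω₂ lam β γ).gibbsMeasure N T).prod wienerPair) := s4.sub j5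
  have pos1 : 0 ≤ ∫ p, (∫ s in (0 : ℝ)..t, (pinnedChain ω₂ lam β γ).bondCurrent N ⟨0, Nat.zero_lt_of_lt hN⟩ ((pinnedChain ω₂ lam β γ).solMap N T T s p.1 (pairPath p.2))) * (∫ s in (0 : ℝ)..t, (pinnedChain ω₂ lam β γ).bondCurrent N ⟨0, Nat.zero_lt_of_lt hN⟩ ((pinnedChain ω₂ lam β γ).solMap N T T s p.1 (pairPath p.2))) ∂(((pinnedChain ω₂ lam β γ).gibbsMeasure N T).prod wienerPair) + 4 * ∫ p, ((((pinnedChain ω₂ lam β γ).solMap N T T t p.1 (pairPath p.2)).2 ⟨0, Nat.zero_lt_of_lt hN⟩) ^ 2 / 2 + (pinnedChain ω₂ lam β γ).U (((pinnedChain ω₂ lam β γ).solMap N T T t p.1 (pairPath p.2)).1 ⟨0, Nat.zero_lt_of_lt hN⟩) + (pinnedChain ω₂ lam β γ).V (((pinnedChain ω₂ lam β γ).solMap N T T t p.1 (pairPath p.2)).1 ⟨1, hN⟩ - ((pinnedChain ω₂ lam β γ).solMap N T T t p.1 (pairPath p.2)).1 ⟨0, Nat.zero_lt_of_lt hN⟩)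 / 2) * ((((pinnedChain ω₂ lam β γ).solMap N T T t p.1 (pairPath p.2)).2 ⟨0, Nat.zero_lt_of_lt hN⟩) ^ 2 / 2 + (pinnedChain ω₂ lam β γ).U (((pinnedChain ω₂ lam β γ).solMap N T T t p.1 (pairPath p.2)).1 ⟨0, Nat.zero_lt_of_lt hN⟩) + (pinnedChain ω₂ lam β γ).V (((pinnedChain ω₂ lam β γ).solMap N T T t p.1 (pairPath p.2)).1 ⟨1, hN⟩ - ((pinnedChain ω₂ lam β γ).solMap N T T t p.1 (pairPath p.2)).1 ⟨0, Nat.zero_lt_of_lt hN⟩) / 2) ∂(((pinnedChain ω₂ lam β γ).gibbsMeasure N T).prod wienerPair) + 4 * ∫ p, ((((pinnedChain ω₂ lam β γ).solMap N T T 0 p.1 (pairPath p.2)).2 ⟨0, Nat.zero_lt_of_lt hN⟩) ^ 2 / 2 + (pinnedChain ω₂ lam β γ).U (((pinnedChain ω₂ lam β γ).solMap N T T 0 p.1 (pairPath p.2)).1 ⟨0, Nat.zero_lt_of_lt hN⟩) + (pinnedChain ω₂ lam β γ).V (((pinnedChain ω₂ lam β γ).solMap N T T 0 p.1 (pairPath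 p.2)).1 ⟨1, hN⟩ - ((pinnedChain ω₂ lam β γ).solMap N T T 0 p.1 (pairPath p.2)).1 ⟨0, Nat.zero_lt_of_lt hN⟩) / 2) * ((((pinnedChain ω₂ lam β γ).solMap N T T 0 p.1 (pairPath p.2)).2 ⟨0, Nat.zero_lt_of_lt hN⟩) ^ 2 / 2 + (pinnedChain ω₂ lam β γ).U (((pinnedChain ω₂ lam β γ).solMap N T T 0 p.1 (pairPath p.2)).1 ⟨0, Nat.zero_lt_of_lt hN⟩) + (pinnedChain ω₂ lam β γ).V (((pinnedChain ω₂ lam β γ).solMap N T T 0 p.1 (pairPath p.2)).1 ⟨1, hN⟩ - ((pinnedChain ω₂ lam β γ).solMap N T T 0 p.1 (pairPath p.2)).1 ⟨0, Nat.zero_lt_of_lt hN⟩) / 2) ∂(((pinnedChain ω₂ lam β γ).gibbsMeasure N T).prod wienerPair) +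
      4 * ∫ p, ((((pinnedChain ω₂ lam β γ).solMap N T T t p.1 (pairPath p.2)).2 ⟨0, Nat.zero_lt_of_lt hN⟩) ^ 2 / 2 + (pinnedChain ω₂ lam β γ).U (((pinnedChain ω₂ lam β γ).solMap N T T t p.1 (pairPath p.2)).1 ⟨0, Nat.zero_lt_of_lt hN⟩) + (pinnedChain ω₂ lam β γ).V (((pinnedChain ω₂ lam β γ).solMap N T T t p.1 (pairPath p.2)).1 ⟨1, hN⟩ - ((pinnedChain ω₂ lam β γ).solMap N T T t p.1 (pairPath p.2)).1 ⟨0, Nat.zero_lt_of_lt hN⟩) / 2) * (∫ s in (0 : ℝ)..t, (pinnedChain ω₂ lam β γ).bondCurrent N ⟨0, Nat.zero_lt_of_lt hN⟩ ((pinnedChain ω₂ lam β γ).solMap N T T s p.1 (pairPath p.2))) ∂(((pinnedChain ω₂ lam β γ).gibbsMeasure N T).prod wienerPair) - 4 * ∫ p, ((((pinnedChain ω₂ lam β γ).solMap N T T 0 p.1 (pairPath p.2)).2 ⟨0, Nat.zero_lt_of_lt hN⟩) ^ 2 / 2 + (pinnedChain ω₂ lam β γ).U (((pinnedChain ω₂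 lam β γ).solMap N T T 0 p.1 (pairPath p.2)).1 ⟨0, Nat.zero_lt_of_lt hN⟩) + (pinnedChain ω₂ lam β γ).V (((pinnedChain ω₂ lam β γ).solMap N T T 0 p.1 (pairPath p.2)).1 ⟨1, hN⟩ - ((pinnedChain ω₂ lam β γ).solMap N T T 0 p.1 (pairPath p.2)).1 ⟨0, Nat.zero_lt_of_lt hN⟩) / 2) * (∫ s in (0 : ℝ)..t, (pinnedChain ω₂ lam β γ).bondCurrent N ⟨0, Nat.zero_lt_of_lt hN⟩ ((pinnedChain ω₂ lam β γ).solMap N T T s p.1 (pairPath p.2))) ∂(((pinnedChain ω₂ lam β γ).gibbsMeasure N T).prod wienerPair) - 8 * ∫ p, ((((pinnedChain ω₂ lam β γ).solMap N T T 0 p.1 (pairPath p.2)).2 ⟨0, Nat.zero_lt_of_lt hN⟩) ^ 2 / 2 + (pinnedChain ω₂ lam β γ).U (((pinnedChain ω₂ lam β γ).solMap N T T 0 p.1 (pairPath p.2)).1 ⟨0, Nat.zero_lt_of_lt hN⟩) + (pinnedChain ω₂ lam β γ).V (((pinnedChain ω₂ lam β γ).solMap N T T 0 p.1 (pairPath p.2)).1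 ⟨1, hN⟩ - ((pinnedChain ω₂ lam β γ).solMap N T T 0 p.1 (pairPath p.2)).1 ⟨0, Nat.zero_lt_of_lt hN⟩) / 2) * ((((pinnedChain ω₂ lam β γ).solMap N T T t p.1 (pairPath p.2)).2 ⟨0, Nat.zero_lt_of_lt hN⟩) ^ 2 / 2 + (pinnedChain ω₂ lam β γ).U (((pinnedChain ω₂ lam β γ).solMap N T T t p.1 (pairPath p.2)).1 ⟨0, Nat.zero_lt_of_lt hN⟩) + (pinnedChain ω₂ lam β γ).V (((pinnedChain ω₂ lam β γ).solMap N T T t p.1 (pairPath p.2)).1 ⟨1, hN⟩ - ((pinnedChain ω₂ lam β γ).solMap N T T t p.1 (pairPath p.2)).1 ⟨0, Nat.zero_lt_of_lt hN⟩) / 2) ∂(((pinnedChain ω₂ lam β γ).gibbsMeasure N T).prod wienerPair) := by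
    have h : ∀ p : PhaseSpace N × WienerPair,
        ((∫ s in (0 : ℝ)..t, (pinnedChain ω₂ lam β γ).bondCurrent N ⟨0, Nat.zero_lt_of_lt hN⟩ ((pinnedChain ω₂ lam β γ).solMap N T T s p.1 (pairPath p.2))) + 2 * ((((pinnedChain ω₂ lam β γ).solMap N T T t p.1 (pairPath p.2)).2 ⟨0, Nat.zero_lt_of_lt hN⟩) ^ 2 / 2 + (pinnedChain ω₂ lam β γ).U (((pinnedChain ω₂ lam β γ).solMap N T T t p.1 (pairPath p.2)).1 ⟨0, Nat.zero_lt_of_lt hN⟩) + (pinnedChain ω₂ lam β γ).V (((pinnedChain ω₂ lam β γ).solMap N T T t p.1 (pairPath p.2)).1 ⟨1, hN⟩ - ((pinnedChain ω₂ lam β γ).solMap N T T t p.1 (pairPath p.2)).1 ⟨0, Nat.zero_lt_of_lt hN⟩) / 2) - 2 * ((((pinnedChain ω₂ lam β γ).solMap N T T 0 p.1 (pairPath p.2)).2 ⟨0, Nat.zero_lt_of_lt hN⟩) ^ 2 / 2 + (pinnedChain ω₂ lam β γ).U (((pinnedChain ω₂ lam β γ).solMap N T T 0 p.1 (pairPath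 p.2)).1 ⟨0, Nat.zero_lt_of_lt hN⟩) + (pinnedChain ω₂ lam β γ).V (((pinnedChain ω₂ lam β γ).solMap N T T 0 p.1 (pairPath p.2)).1 ⟨1, hN⟩ - ((pinnedChain ω₂ lam β γ).solMap N T T 0 p.1 (pairPath p.2)).1 ⟨0, Nat.zero_lt_of_lt hN⟩) / 2)) ^ 2 =
        (∫ s in (0 : ℝ)..t, (pinnedChain ω₂ lam β γ).bondCurrent N ⟨0, Nat.zero_lt_of_lt hN⟩ ((pinnedChain ω₂ lam β γ).solMap N T T s p.1 (pairPath p.2))) * (∫ s in (0 : ℝ)..t, (pinnedChain ω₂ lam β γ).bondCurrent N ⟨0, Nat.zero_lt_of_lt hN⟩ ((pinnedChain ω₂ lam β γ).solMap N T T s p.1 (pairPath p.2))) + 4 * (((((pinnedChain ω₂ lam β γ).solMap N T T t p.1 (pairPath p.2)).2 ⟨0, Nat.zero_lt_of_lt hN⟩) ^ 2 / 2 + (pinnedChain ω₂ lam β γ).U (((pinnedChain ω₂ lam β γ).solMap N T T t p.1 (pairPath p.2)).1 ⟨0, Nat.zero_lt_of_lt hN⟩) + (pinnedChain ω₂ lam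 β γ).V (((pinnedChain ω₂ lam β γ).solMap N T T t p.1 (pairPath p.2)).1 ⟨1, hN⟩ - ((pinnedChain ω₂ lam β γ).solMap N T T t p.1 (pairPath p.2)).1 ⟨0, Nat.zero_lt_of_lt hN⟩) / 2) * ((((pinnedChain ω₂ lam β γ).solMap N T T t p.1 (pairPath p.2)).2 ⟨0, Nat.zero_lt_of_lt hN⟩) ^ 2 / 2 + (pinnedChain ω₂ lam β γ).U (((pinnedChain ω₂ lam β γ).solMap N T T t p.1 (pairPath p.2)).1 ⟨0, Nat.zero_lt_of_lt hN⟩) + (pinnedChain ω₂ lam β γ).V (((pinnedChain ω₂ lam β γ).solMap N T T t p.1 (pairPath p.2)).1 ⟨1, hN⟩ - ((pinnedChain ω₂ lam β γ).solMap N T T t p.1 (pairPath p.2)).1 ⟨0, Nat.zero_lt_of_lt hN⟩) / 2)) + 4 * (((((pinnedChain ω₂ lam β γ).solMap N T T 0 p.1 (pairPath p.2)).2 ⟨0, Nat.zero_lt_of_lt hN⟩) ^ 2 / 2 + (pinnedChain ω₂ lam β γ).U (((pinnedChain ω₂ lam β γ).solMap N T T 0 p.1 (pairPath p.2)).1 ⟨0,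 Nat.zero_lt_of_lt hN⟩) + (pinnedChain ω₂ lam β γ).V (((pinnedChain ω₂ lam β γ).solMap N T T 0 p.1 (pairPath p.2)).1 ⟨1, hN⟩ - ((pinnedChain ω₂ lam β γ).solMap N T T 0 p.1 (pairPath p.2)).1 ⟨0, Nat.zero_lt_of_lt hN⟩) / 2) * ((((pinnedChain ω₂ lam β γ).solMap N T T 0 p.1 (pairPath p.2)).2 ⟨0, Nat.zero_lt_of_lt hN⟩) ^ 2 / 2 + (pinnedChain ω₂ lam β γ).U (((pinnedChain ω₂ lam β γ).solMap N T T 0 p.1 (pairPath p.2)).1 ⟨0, Nat.zero_lt_of_lt hN⟩) + (pinnedChain ω₂ lam β γ).V (((pinnedChain ω₂ lam β γ).solMap N T T 0 p.1 (pairPath p.2)).1 ⟨1, hN⟩ - ((pinnedChain ω₂ lam β γ).solMap N T T 0 p.1 (pairPath p.2)).1 ⟨0, Nat.zero_lt_of_lt hN⟩) / 2)) + 4 * (((((pinnedChain ω₂ lam β γ).solMap N T T t p.1 (pairPath p.2)).2 ⟨0, Nat.zero_lt_of_lt hN⟩) ^ 2 / 2 + (pinnedChain ω₂ lam β γ).U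 (((pinnedChain ω₂ lam β γ).solMap N T T t p.1 (pairPath p.2)).1 ⟨0, Nat.zero_lt_of_lt hN⟩) + (pinnedChain ω₂ lam β γ).V (((pinnedChain ω₂ lam β γ).solMap N T T t p.1 (pairPath p.2)).1 ⟨1, hN⟩ - ((pinnedChain ω₂ lam β γ).solMap N T T t p.1 (pairPath p.2)).1 ⟨0, Nat.zero_lt_of_lt hN⟩) / 2) * (∫ s in (0 : ℝ)..t, (pinnedChain ω₂ lam β γ).bondCurrent N ⟨0, Nat.zero_lt_of_lt hN⟩ ((pinnedChain ω₂ lam β γ).solMap N T T s p.1 (pairPath p.2)))) -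
          4 * (((((pinnedChain ω₂ lam β γ).solMap N T T 0 p.1 (pairPath p.2)).2 ⟨0, Nat.zero_lt_of_lt hN⟩) ^ 2 / 2 + (pinnedChain ω₂ lam β γ).U (((pinnedChain ω₂ lam β γ).solMap N T T 0 p.1 (pairPath p.2)).1 ⟨0, Nat.zero_lt_of_lt hN⟩) + (pinnedChain ω₂ lam β γ).V (((pinnedChain ω₂ lam β γ).solMap N T T 0 p.1 (pairPath p.2)).1 ⟨1, hN⟩ - ((pinnedChain ω₂ lam β γ).solMap N T T 0 p.1 (pairPath p.2)).1 ⟨0, Nat.zero_lt_of_lt hN⟩) / 2) * (∫ s in (0 : ℝ)..t, (pinnedChain ω₂ lam β γ).bondCurrent N ⟨0, Nat.zero_lt_of_lt hN⟩ ((pinnedChain ω₂ lam β γ).solMap N T T s p.1 (pairPath p.2)))) - 8 * (((((pinnedChain ω₂ lam β γ).solMap N T T 0 p.1 (pairPath p.2)).2 ⟨0, Nat.zero_lt_of_lt hN⟩) ^ 2 / 2 + (pinnedChain ω₂ lam β γ).U (((pinnedChain ω₂ lam β γ).solMap N T T 0 p.1 (pairPath p.2)).1 ⟨0, Nat.zero_lt_of_lt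 hN⟩) + (pinnedChain ω₂ lam β γ).V (((pinnedChain ω₂ lam β γ).solMap N T T 0 p.1 (pairPath p.2)).1 ⟨1, hN⟩ - ((pinnedChain ω₂ lam β γ).solMap N T T 0 p.1 (pairPath p.2)).1 ⟨0, Nat.zero_lt_of_lt hN⟩) / 2) * ((((pinnedChain ω₂ lam β γ).solMap N T T t p.1 (pairPath p.2)).2 ⟨0, Nat.zero_lt_of_lt hN⟩) ^ 2 / 2 + (pinnedChain ω₂ lam β γ).U (((pinnedChain ω₂ lam β γ).solMap N T T t p.1 (pairPath p.2)).1 ⟨0, Nat.zero_lt_of_lt hN⟩) + (pinnedChain ω₂ lam β γ).V (((pinnedChain ω₂ lam β γ).solMap N T T t p.1 (pairPath p.2)).1 ⟨1, hN⟩ - ((pinnedChain ω₂ lam β γ).solMap N T T t p.1 (pairPath p.2)).1 ⟨0, Nat.zero_lt_of_lt hN⟩) / 2)) := by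
      intro p; ring
    have hnn : 0 ≤ ∫ p, ((∫ s in (0 : ℝ)..t, (pinnedChain ω₂ lam β γ).bondCurrent N ⟨0, Nat.zero_lt_of_lt hN⟩ ((pinnedChain ω₂ lam β γ).solMap N T T s p.1 (pairPath p.2))) + 2 * ((((pinnedChain ω₂ lam β γ).solMap N T T t p.1 (pairPath p.2)).2 ⟨0, Nat.zero_lt_of_lt hN⟩) ^ 2 / 2 + (pinnedChain ω₂ lam β γ).U (((pinnedChain ω₂ lam β γ).solMap N T T t p.1 (pairPath p.2)).1 ⟨0, Nat.zero_lt_of_lt hN⟩) + (pinnedChain ω₂ lam β γ).V (((pinnedChain ω₂ lam β γ).solMap N T T t p.1 (pairPath p.2)).1 ⟨1, hN⟩ - ((pinnedChain ω₂ lam β γ).solMap N T T t p.1 (pairPath p.2)).1 ⟨0, Nat.zero_lt_of_lt hN⟩) / 2) - 2 * ((((pinnedChain ω₂ lam β γ).solMap N T T 0 p.1 (pairPath p.2)).2 ⟨0, Nat.zero_lt_of_lt hN⟩) ^ 2 / 2 + (pinnedChain ω₂ lam β γ).U (((pinnedChain ω₂ lam β γ).solMap N T T 0 p.1 (pairPath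 p.2)).1 ⟨0, Nat.zero_lt_of_lt hN⟩) + (pinnedChain ω₂ lam β γ).V (((pinnedChain ω₂ lam β γ).solMap N T T 0 p.1 (pairPath p.2)).1 ⟨1, hN⟩ - ((pinnedChain ω₂ lam β γ).solMap N T T 0 p.1 (pairPath p.2)).1 ⟨0, Nat.zero_lt_of_lt hN⟩) / 2)) ^ 2 ∂(((pinnedChain ω₂ lam β γ).gibbsMeasure N T).prod wienerPair) := integral_nonneg fun p => sq_nonneg _
    rw [integral_congr_ae (Eventually.of_forall h), MeasureTheory.integral_sub s5 j6, MeasureTheory.integral_sub s4 j5,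
      MeasureTheory.integral_add s3 j4, MeasureTheory.integral_add s2 j3, MeasureTheory.integral_add iXX j2,
      MeasureTheory.integral_const_mul, MeasureTheory.integral_const_mul, MeasureTheory.integral_const_mul,
      MeasureTheory.integral_const_mul, MeasureTheory.integral_const_mul] at hnn
    exact hnn
  have j7 : Integrable (fun p : PhaseSpace N × WienerPair => 2 * (((((pinnedChain ω₂ lam β γ).solMap N T T 0 p.1 (pairPath p.2)).2 ⟨0, Nat.zero_lt_of_lt hN⟩) ^ 2 / 2 + (pinnedChain ω₂ lam β γ).U (((pinnedChain ω₂ lam β γ).solMap N T T 0 p.1 (pairPath p.2)).1 ⟨0, Nat.zero_lt_of_lt hN⟩) + (pinnedChain ω₂ lam β γ).V (((pinnedChain ω₂ lam β γ).solMap N T T 0 p.1 (pairPath p.2)).1 ⟨1, hN⟩ - ((pinnedChain ω₂ lam β γ).solMap N T T 0 p.1 (pairPath p.2)).1 ⟨0, Nat.zero_lt_of_lt hN⟩) / 2) * ((((pinnedChain ω₂ lam β γ).solMap N T T t p.1 (pairPath p.2)).2 ⟨0, Nat.zero_lt_of_lt hN⟩) ^ 2 / 2 + (pinnedChain ω₂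 lam β γ).U (((pinnedChain ω₂ lam β γ).solMap N T T t p.1 (pairPath p.2)).1 ⟨0, Nat.zero_lt_of_lt hN⟩) + (pinnedChain ω₂ lam β γ).V (((pinnedChain ω₂ lam β γ).solMap N T T t p.1 (pairPath p.2)).1 ⟨1, hN⟩ - ((pinnedChain ω₂ lam β γ).solMap N T T t p.1 (pairPath p.2)).1 ⟨0, Nat.zero_lt_of_lt hN⟩) / 2))) (((pinnedChain ω₂ lam β γ).gibbsMeasure N T).prod wienerPair) := i0t.const_mul 2
  have s7 : Integrable (fun p : PhaseSpace N × WienerPair => ((((pinnedChain ω₂ lam β γ).solMap N T T t p.1 (pairPath p.2)).2 ⟨0, Nat.zero_lt_of_lt hN⟩) ^ 2 / 2 + (pinnedChain ω₂ lam β γ).U (((pinnedChain ω₂ lam β γ).solMap N T T t p.1 (pairPath p.2)).1 ⟨0, Nat.zero_lt_of_lt hN⟩) + (pinnedChain ω₂ lam β γ).V (((pinnedChain ω₂ lam β γ).solMap N T T t p.1 (pairPath p.2)).1 ⟨1, hN⟩ - ((pinnedChain ω₂ lam β γ).solMap N T T t p.1 (pairPath p.2)).1 ⟨0, Nat.zero_lt_of_lt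 hN⟩) / 2) * ((((pinnedChain ω₂ lam β γ).solMap N T T t p.1 (pairPath p.2)).2 ⟨0, Nat.zero_lt_of_lt hN⟩) ^ 2 / 2 + (pinnedChain ω₂ lam β γ).U (((pinnedChain ω₂ lam β γ).solMap N T T t p.1 (pairPath p.2)).1 ⟨0, Nat.zero_lt_of_lt hN⟩) + (pinnedChain ω₂ lam β γ).V (((pinnedChain ω₂ lam β γ).solMap N T T t p.1 (pairPath p.2)).1 ⟨1, hN⟩ - ((pinnedChain ω₂ lam β γ).solMap N T T t p.1 (pairPath p.2)).1 ⟨0, Nat.zero_lt_of_lt hN⟩) / 2) + 2 * (((((pinnedChain ω₂ lam β γ).solMap N T T 0 p.1 (pairPath p.2)).2 ⟨0, Nat.zero_lt_of_lt hN⟩) ^ 2 / 2 + (pinnedChain ω₂ lam β γ).U (((pinnedChain ω₂ lam β γ).solMap N T T 0 p.1 (pairPath p.2)).1 ⟨0, Nat.zero_lt_of_lt hN⟩) + (pinnedChain ω₂ lam β γ).V (((pinnedChain ω₂ lam β γ).solMap N T T 0 p.1 (pairPath p.2)).1 ⟨1, hN⟩ - ((pinnedChain ω₂ lam β γ).solMap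 N T T 0 p.1 (pairPath p.2)).1 ⟨0, Nat.zero_lt_of_lt hN⟩) / 2) * ((((pinnedChain ω₂ lam β γ).solMap N T T t p.1 (pairPath p.2)).2 ⟨0, Nat.zero_lt_of_lt hN⟩) ^ 2 / 2 + (pinnedChain ω₂ lam β γ).U (((pinnedChain ω₂ lam β γ).solMap N T T t p.1 (pairPath p.2)).1 ⟨0, Nat.zero_lt_of_lt hN⟩) + (pinnedChain ω₂ lam β γ).V (((pinnedChain ω₂ lam β γ).solMap N T T t p.1 (pairPath p.2)).1 ⟨1, hN⟩ - ((pinnedChain ω₂ lam β γ).solMap N T T t p.1 (pairPath p.2)).1 ⟨0, Nat.zero_lt_of_lt hN⟩) / 2))) (((pinnedChain ω₂ lam β γ).gibbsMeasure N T).prod wienerPair) := itt'.add j7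
  have pos2 : 0 ≤ ∫ p, ((((pinnedChain ω₂ lam β γ).solMap N T T t p.1 (pairPath p.2)).2 ⟨0, Nat.zero_lt_of_lt hN⟩) ^ 2 / 2 + (pinnedChain ω₂ lam β γ).U (((pinnedChain ω₂ lam β γ).solMap N T T t p.1 (pairPath p.2)).1 ⟨0, Nat.zero_lt_of_lt hN⟩) + (pinnedChain ω₂ lam β γ).V (((pinnedChain ω₂ lam β γ).solMap N T T t p.1 (pairPath p.2)).1 ⟨1, hN⟩ - ((pinnedChain ω₂ lam β γ).solMap N T T t p.1 (pairPath p.2)).1 ⟨0, Nat.zero_lt_of_lt hN⟩) / 2) * ((((pinnedChain ω₂ lam β γ).solMap N T T t p.1 (pairPath p.2)).2 ⟨0, Nat.zero_lt_of_lt hN⟩) ^ 2 / 2 + (pinnedChain ω₂ lam β γ).U (((pinnedChain ω₂ lam β γ).solMap N T T t p.1 (pairPath p.2)).1 ⟨0, Nat.zero_lt_of_lt hN⟩) + (pinnedChain ω₂ lam β γ).V (((pinnedChain ω₂ lam β γ).solMap N T T t p.1 (pairPath p.2)).1 ⟨1, hN⟩ - ((pinnedChain ω₂ lam β γ).solMap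 N T T t p.1 (pairPath p.2)).1 ⟨0, Nat.zero_lt_of_lt hN⟩) / 2) ∂(((pinnedChain ω₂ lam β γ).gibbsMeasure N T).prod wienerPair) + 2 * ∫ p, ((((pinnedChain ω₂ lam β γ).solMap N T T 0 p.1 (pairPath p.2)).2 ⟨0, Nat.zero_lt_of_lt hN⟩) ^ 2 / 2 + (pinnedChain ω₂ lam β γ).U (((pinnedChain ω₂ lam β γ).solMap N T T 0 p.1 (pairPath p.2)).1 ⟨0, Nat.zero_lt_of_lt hN⟩) + (pinnedChain ω₂ lam β γ).V (((pinnedChain ω₂ lam β γ).solMap N T T 0 p.1 (pairPath p.2)).1 ⟨1, hN⟩ - ((pinnedChain ω₂ lam β γ).solMap N T T 0 p.1 (pairPath p.2)).1 ⟨0, Nat.zero_lt_of_lt hN⟩) / 2) * ((((pinnedChain ω₂ lam β γ).solMap N T T t p.1 (pairPath p.2)).2 ⟨0, Nat.zero_lt_of_lt hN⟩) ^ 2 / 2 + (pinnedChain ω₂ lam β γ).U (((pinnedChain ω₂ lam β γ).solMap N T T t p.1 (pairPath p.2)).1 ⟨0, Nat.zero_lt_of_lt hN⟩) + (pinnedChain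 ω₂ lam β γ).V (((pinnedChain ω₂ lam β γ).solMap N T T t p.1 (pairPath p.2)).1 ⟨1, hN⟩ - ((pinnedChain ω₂ lam β γ).solMap N T T t p.1 (pairPath p.2)).1 ⟨0, Nat.zero_lt_of_lt hN⟩) / 2) ∂(((pinnedChain ω₂ lam β γ).gibbsMeasure N T).prod wienerPair) + ∫ p, ((((pinnedChain ω₂ lam β γ).solMap N T T 0 p.1 (pairPath p.2)).2 ⟨0, Nat.zero_lt_of_lt hN⟩) ^ 2 / 2 + (pinnedChain ω₂ lam β γ).U (((pinnedChain ω₂ lam β γ).solMap N T T 0 p.1 (pairPath p.2)).1 ⟨0, Nat.zero_lt_of_lt hN⟩) + (pinnedChain ω₂ lam β γ).V (((pinnedChain ω₂ lam β γ).solMap N T T 0 p.1 (pairPath p.2)).1 ⟨1, hN⟩ - ((pinnedChain ω₂ lam β γ).solMap N T T 0 p.1 (pairPath p.2)).1 ⟨0, Nat.zero_lt_of_lt hN⟩) / 2) * ((((pinnedChain ω₂ lam β γ).solMap N T T 0 p.1 (pairPath p.2)).2 ⟨0, Nat.zero_lt_of_lt hN⟩) ^ 2 / 2 + (pinnedChain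 ω₂ lam β γ).U (((pinnedChain ω₂ lam β γ).solMap N T T 0 p.1 (pairPath p.2)).1 ⟨0, Nat.zero_lt_of_lt hN⟩) + (pinnedChain ω₂ lam β γ).V (((pinnedChain ω₂ lam β γ).solMap N T T 0 p.1 (pairPath p.2)).1 ⟨1, hN⟩ - ((pinnedChain ω₂ lam β γ).solMap N T T 0 p.1 (pairPath p.2)).1 ⟨0, Nat.zero_lt_of_lt hN⟩) / 2) ∂(((pinnedChain ω₂ lam β γ).gibbsMeasure N T).prod wienerPair) := by
    have h : ∀ p : PhaseSpace N × WienerPair,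
        (((((pinnedChain ω₂ lam β γ).solMap N T T t p.1 (pairPath p.2)).2 ⟨0, Nat.zero_lt_of_lt hN⟩) ^ 2 / 2 + (pinnedChain ω₂ lam β γ).U (((pinnedChain ω₂ lam β γ).solMap N T T t p.1 (pairPath p.2)).1 ⟨0, Nat.zero_lt_of_lt hN⟩) + (pinnedChain ω₂ lam β γ).V (((pinnedChain ω₂ lam β γ).solMap N T T t p.1 (pairPath p.2)).1 ⟨1, hN⟩ - ((pinnedChain ω₂ lam β γ).solMap N T T t p.1 (pairPath p.2)).1 ⟨0, Nat.zero_lt_of_lt hN⟩) / 2) + ((((pinnedChain ω₂ lam β γ).solMap N T T 0 p.1 (pairPath p.2)).2 ⟨0, Nat.zero_lt_of_lt hN⟩) ^ 2 / 2 + (pinnedChain ω₂ lam β γ).U (((pinnedChain ω₂ lam β γ).solMap N T T 0 p.1 (pairPath p.2)).1 ⟨0, Nat.zero_lt_of_lt hN⟩) + (pinnedChain ω₂ lam β γ).V (((pinnedChain ω₂ lam β γ).solMap N T T 0 p.1 (pairPath p.2)).1 ⟨1, hN⟩ - ((pinnedChain ω₂ lam β γ).solMap N T T 0 p.1 (pairPath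 p.2)).1 ⟨0, Nat.zero_lt_of_lt hN⟩) / 2)) ^ 2 = ((((pinnedChain ω₂ lam β γ).solMap N T T t p.1 (pairPath p.2)).2 ⟨0, Nat.zero_lt_of_lt hN⟩) ^ 2 / 2 + (pinnedChain ω₂ lam β γ).U (((pinnedChain ω₂ lam β γ).solMap N T T t p.1 (pairPath p.2)).1 ⟨0, Nat.zero_lt_of_lt hN⟩) + (pinnedChain ω₂ lam β γ).V (((pinnedChain ω₂ lam β γ).solMap N T T t p.1 (pairPath p.2)).1 ⟨1, hN⟩ - ((pinnedChain ω₂ lam β γ).solMap N T T t p.1 (pairPath p.2)).1 ⟨0, Nat.zero_lt_of_lt hN⟩) / 2) * ((((pinnedChain ω₂ lam β γ).solMap N T T t p.1 (pairPath p.2)).2 ⟨0, Nat.zero_lt_of_lt hN⟩) ^ 2 / 2 + (pinnedChain ω₂ lam β γ).U (((pinnedChain ω₂ lam β γ).solMap N T T t p.1 (pairPath p.2)).1 ⟨0, Nat.zero_lt_of_lt hN⟩) + (pinnedChain ω₂ lam β γ).V (((pinnedChain ω₂ lam β γ).solMap N T T t p.1 (pairPath p.2)).1 ⟨1, hN⟩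 - ((pinnedChain ω₂ lam β γ).solMap N T T t p.1 (pairPath p.2)).1 ⟨0, Nat.zero_lt_of_lt hN⟩) / 2) + 2 * (((((pinnedChain ω₂ lam β γ).solMap N T T 0 p.1 (pairPath p.2)).2 ⟨0, Nat.zero_lt_of_lt hN⟩) ^ 2 / 2 + (pinnedChain ω₂ lam β γ).U (((pinnedChain ω₂ lam β γ).solMap N T T 0 p.1 (pairPath p.2)).1 ⟨0, Nat.zero_lt_of_lt hN⟩) + (pinnedChain ω₂ lam β γ).V (((pinnedChain ω₂ lam β γ).solMap N T T 0 p.1 (pairPath p.2)).1 ⟨1, hN⟩ - ((pinnedChain ω₂ lam β γ).solMap N T T 0 p.1 (pairPath p.2)).1 ⟨0, Nat.zero_lt_of_lt hN⟩) / 2) * ((((pinnedChain ω₂ lam β γ).solMap N T T t p.1 (pairPath p.2)).2 ⟨0, Nat.zero_lt_of_lt hN⟩) ^ 2 / 2 + (pinnedChain ω₂ lam β γ).U (((pinnedChain ω₂ lam β γ).solMap N T T t p.1 (pairPath p.2)).1 ⟨0, Nat.zero_lt_of_lt hN⟩) + (pinnedChain ω₂ lam β γ).V (((pinnedChain ω₂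 lam β γ).solMap N T T t p.1 (pairPath p.2)).1 ⟨1, hN⟩ - ((pinnedChain ω₂ lam β γ).solMap N T T t p.1 (pairPath p.2)).1 ⟨0, Nat.zero_lt_of_lt hN⟩) / 2)) + ((((pinnedChain ω₂ lam β γ).solMap N T T 0 p.1 (pairPath p.2)).2 ⟨0, Nat.zero_lt_of_lt hN⟩) ^ 2 / 2 + (pinnedChain ω₂ lam β γ).U (((pinnedChain ω₂ lam β γ).solMap N T T 0 p.1 (pairPath p.2)).1 ⟨0, Nat.zero_lt_of_lt hN⟩) + (pinnedChain ω₂ lam β γ).V (((pinnedChain ω₂ lam β γ).solMap N T T 0 p.1 (pairPath p.2)).1 ⟨1, hN⟩ - ((pinnedChain ω₂ lam β γ).solMap N T T 0 p.1 (pairPath p.2)).1 ⟨0, Nat.zero_lt_of_lt hN⟩) / 2) * ((((pinnedChain ω₂ lam β γ).solMap N T T 0 p.1 (pairPath p.2)).2 ⟨0, Nat.zero_lt_of_lt hN⟩) ^ 2 / 2 + (pinnedChain ω₂ lam β γ).U (((pinnedChain ω₂ lam β γ).solMap N T T 0 p.1 (pairPath p.2)).1 ⟨0, Nat.zero_lt_of_lt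 hN⟩) + (pinnedChain ω₂ lam β γ).V (((pinnedChain ω₂ lam β γ).solMap N T T 0 p.1 (pairPath p.2)).1 ⟨1, hN⟩ - ((pinnedChain ω₂ lam β γ).solMap N T T 0 p.1 (pairPath p.2)).1 ⟨0, Nat.zero_lt_of_lt hN⟩) / 2) := by
      intro p; ring
    have hnn : 0 ≤ ∫ p, (((((pinnedChain ω₂ lam β γ).solMap N T T t p.1 (pairPath p.2)).2 ⟨0, Nat.zero_lt_of_lt hN⟩) ^ 2 / 2 + (pinnedChain ω₂ lam β γ).U (((pinnedChain ω₂ lam β γ).solMap N T T t p.1 (pairPath p.2)).1 ⟨0, Nat.zero_lt_of_lt hN⟩) + (pinnedChain ω₂ lam β γ).V (((pinnedChain ω₂ lam β γ).solMap N T T t p.1 (pairPath p.2)).1 ⟨1, hN⟩ - ((pinnedChain ω₂ lam β γ).solMap N T T t p.1 (pairPath p.2)).1 ⟨0, Nat.zero_lt_of_lt hN⟩) / 2) + ((((pinnedChain ω₂ lam β γ).solMap N T T 0 p.1 (pairPath p.2)).2 ⟨0, Nat.zero_lt_of_lt hN⟩) ^ 2 / 2 + (pinnedChain ω₂ lam β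 γ).U (((pinnedChain ω₂ lam β γ).solMap N T T 0 p.1 (pairPath p.2)).1 ⟨0, Nat.zero_lt_of_lt hN⟩) + (pinnedChain ω₂ lam β γ).V (((pinnedChain ω₂ lam β γ).solMap N T T 0 p.1 (pairPath p.2)).1 ⟨1, hN⟩ - ((pinnedChain ω₂ lam β γ).solMap N T T 0 p.1 (pairPath p.2)).1 ⟨0, Nat.zero_lt_of_lt hN⟩) / 2)) ^ 2 ∂(((pinnedChain ω₂ lam β γ).gibbsMeasure N T).prod wienerPair) := integral_nonneg fun p => sq_nonneg _
    rw [integral_congr_ae (Eventually.of_forall h), MeasureTheory.integral_add s7 i00',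
      MeasureTheory.integral_add itt' j7, MeasureTheory.integral_const_mul] at hnn
    exact hnn
  -- the static inequality in the form `-⟨ℓ, e⟩ ≤ γ T²`
  have hLE : -(∫ y, (γ * (T - (y.2 ⟨0, Nat.zero_lt_of_lt hN⟩) ^ 2) - (pinnedChain ω₂ lam β γ).bondCurrent N ⟨0, Nat.zero_lt_of_lt hN⟩ y) * ((y.2 ⟨0, Nat.zero_lt_of_lt hN⟩) ^ 2 / 2 + (pinnedChain ω₂ lam β γ).U (y.1 ⟨0, Nat.zero_lt_of_lt hN⟩) + (pinnedChain ω₂ lam β γ).V (y.1 ⟨1, hN⟩ - y.1 ⟨0, Nat.zero_lt_of_lt hN⟩) / 2) ∂((pinnedChain ω₂ lam β γ).gibbsMeasure N T)) ≤ γ * T ^ 2 := by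
    rw [← MeasureTheory.integral_neg]
    have h : ∀ y : PhaseSpace N, -((γ * (T - (y.2 ⟨0, Nat.zero_lt_of_lt hN⟩) ^ 2) - (pinnedChain ω₂ lam β γ).bondCurrent N ⟨0, Nat.zero_lt_of_lt hN⟩ y) * ((y.2 ⟨0, Nat.zero_lt_of_lt hN⟩) ^ 2 / 2 + (pinnedChain ω₂ lam β γ).U (y.1 ⟨0, Nat.zero_lt_of_lt hN⟩) + (pinnedChain ω₂ lam β γ).V (y.1 ⟨1, hN⟩ - y.1 ⟨0, Nat.zero_lt_of_lt hN⟩) / 2)) = ((y.2 ⟨0, Nat.zero_lt_of_lt hN⟩) ^ 2 / 2 + (pinnedChain ω₂ lam β γ).U (y.1 ⟨0, Nat.zero_lt_of_lt hN⟩) + (pinnedChain ω₂ lam β γ).V (y.1 ⟨1, hN⟩ - y.1 ⟨0, Nat.zero_lt_of_lt hN⟩) / 2) * ((pinnedChain ω₂ lam β γ).bondCurrent N ⟨0, Nat.zero_lt_of_lt hN⟩ y - γ * (T - (y.2 ⟨0, Nat.zero_lt_of_lt hN⟩) ^ 2)) := by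
      intro y; ring
    rw [integral_congr_ae (Eventually.of_forall h)]
    exact hstat
  have htLE : -(t * ∫ y, (γ * (T - (y.2 ⟨0, Nat.zero_lt_of_lt hN⟩) ^ 2) - (pinnedChain ω₂ lam β γ).bondCurrent N ⟨0, Nat.zero_lt_of_lt hN⟩ y) * ((y.2 ⟨0, Nat.zero_lt_of_lt hN⟩) ^ 2 / 2 + (pinnedChain ω₂ lam β γ).U (y.1 ⟨0, Nat.zero_lt_of_lt hN⟩) + (pinnedChain ω₂ lam β γ).V (y.1 ⟨1, hN⟩ - y.1 ⟨0, Nat.zero_lt_of_lt hN⟩) / 2) ∂((pinnedChain ω₂ lam β γ).gibbsMeasure N T)) ≤ t * (γ * T ^ 2) := by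
    have := mul_le_mul_of_nonneg_left hLE ht
    linarith
  -- assemble
  rw [hsqt] at f12
  rw [hsq0] at f13
  rw [subJ] at f4
  rw [subL] at f9
  have hS0 : 0 ≤ ∫ y : PhaseSpace N, ((y.2 ⟨0, Nat.zero_lt_of_lt hN⟩) ^ 2 / 2 + (pinnedChain ω₂ lam β γ).U (y.1 ⟨0, Nat.zero_lt_of_lt hN⟩) + (pinnedChain ω₂ lam β γ).V (y.1 ⟨1, hN⟩ - y.1 ⟨0, Nat.zero_lt_of_lt hN⟩) / 2) ^ 2 ∂((pinnedChain ω₂ lam β γ).gibbsMeasure N T) := integral_nonneg fun y => sq_nonneg _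
  have hSS : ∫ y : PhaseSpace N, ((y.2 ⟨0, Nat.zero_lt_of_lt hN⟩) ^ 2 / 2 + (pinnedChain ω₂ lam β γ).U (y.1 ⟨0, Nat.zero_lt_of_lt hN⟩) + (pinnedChain ω₂ lam β γ).V (y.1 ⟨1, hN⟩ - y.1 ⟨0, Nat.zero_lt_of_lt hN⟩) / 2) * ((y.2 ⟨0, Nat.zero_lt_of_lt hN⟩) ^ 2 / 2 + (pinnedChain ω₂ lam β γ).U (y.1 ⟨0, Nat.zero_lt_of_lt hN⟩) + (pinnedChain ω₂ lam β γ).V (y.1 ⟨1, hN⟩ - y.1 ⟨0, Nat.zero_lt_of_lt hN⟩) / 2) ∂((pinnedChain ω₂ lam β γ).gibbsMeasure N T) = ∫ y : PhaseSpace N, ((y.2 ⟨0, Nat.zero_lt_of_lt hN⟩) ^ 2 / 2 + (pinnedChain ω₂ lam β γ).U (y.1 ⟨0, Nat.zero_lt_of_lt hN⟩) + (pinnedChain ω₂ lam β γ).V (y.1 ⟨1, hN⟩ - y.1 ⟨0, Nat.zero_lt_of_lt hN⟩) / 2) ^ 2 ∂((pinnedChain ω₂ lam β γ).gibbsMeasure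 N T) :=
    integral_congr_ae (Eventually.of_forall fun y => (sq _).symm)
  linarith [hSS, pos1, pos2, f1', f2', f8', hXD0, hED0, lYY, ltY, l0Y, f4, f5, f9, f10, f11, f12, f13, d1, dyn2, hW, htLE,
    hS0]

/-- **The bath-bond reduction, conditional on three kernel/Gibbs facts** (registered sub-goal of
`stub_bathBondReduction`; closed form of `bathBondReduction_conditional`). For the pinned chain (all parameters
`> 0`), `T > 0`, `N ≥ 2`: IF (H2) the constructed kernels satisfy detailed balance under momentum reversal in the
weak `L²` form `∫ f · (P_s h) dμ_T = ∫ (h∘Θ) · P_s (f∘Θ) dμ_T`, (H3) the bath-site energy `e₀` satisfies Dynkin's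
identity for the constructed kernels with `L e₀ = -j₀ + γ(T - p₀²)` (part 1), and (H4) the static Gibbs moment
inequality `∫ e₀ (j₀ - γ(T - p₀²)) dμ_T ≤ γT²` holds (true with EQUALITY: `⟨p₀²⟩ = T`, `⟨p₀⁴⟩ = 3T²`,
`p₀ ⊥ q`), THEN for every `t ≥ 0`: `V_N(0,t) ≤ 4γT² ∫₀ᵗ (1 - θ_N(s)) ds + 8 E_{μ_T}[e₀²]` — verbatim the
conclusion of `stub_bathBondReduction`. Invariance (H1) is no longer a hypothesis
(`pinnedChain_gibbsMeasure_bind_transitionKernel`). [folklore] -/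
theorem stub_bathBondReduction_of_kernelFacts :
    ∀ (ω₂ lam β γ : ℝ), 0 < ω₂ → 0 < lam → 0 < β → 0 < γ → ∀ (T : ℝ), 0 < T → ∀ (N : ℕ) (hN : 1 < N), (∀ (s : NNReal) (f h : PhaseSpace N → ℝ), Measurable f → Measurable h → MeasureTheory.Integrable (fun y => f y ^ 2) ((pinnedChain ω₂ lam β γ).gibbsMeasure N T) → MeasureTheory.Integrable (fun y => h y ^ 2) ((pinnedChain ω₂ lam β γ).gibbsMeasure N T) → ∫ y, f y * (∫ y', h y' ∂((pinnedChain ω₂ lam β γ).transitionKernel N T T s) y) ∂((pinnedChain ω₂ lam β γ).gibbsMeasure N T) = ∫ y, h (y.1, -y.2) * (∫ y', f (y'.1, -y'.2) ∂((pinnedChain ω₂ lam β γ).transitionKernel N T T s) y) ∂((pinnedChain ω₂ lam β γ).gibbsMeasure N T)) → (∀ (r : NNReal) (z : PhaseSpace N), ∫ y, ((y.2 ⟨0, Nat.zero_lt_of_lt hN⟩) ^ 2 / 2 + (pinnedChain ω₂ lam β γ).U (y.1 ⟨0, Nat.zero_lt_of_lt hN⟩) + (pinnedChain ω₂ lam β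 γ).V (y.1 ⟨1, hN⟩ - y.1 ⟨0, Nat.zero_lt_of_lt hN⟩) / 2) ∂((pinnedChain ω₂ lam β γ).transitionKernel N T T r z) - ((z.2 ⟨0, Nat.zero_lt_of_lt hN⟩) ^ 2 / 2 + (pinnedChain ω₂ lam β γ).U (z.1 ⟨0, Nat.zero_lt_of_lt hN⟩) + (pinnedChain ω₂ lam β γ).V (z.1 ⟨1, hN⟩ - z.1 ⟨0, Nat.zero_lt_of_lt hN⟩) / 2) = ∫ s in (0 : ℝ)..(r : ℝ), ∫ y, (γ * (T - (y.2 ⟨0, Nat.zero_lt_of_lt hN⟩) ^ 2) - (pinnedChain ω₂ lam β γ).bondCurrent N ⟨0, Nat.zero_lt_of_lt hN⟩ y) ∂((pinnedChain ω₂ lam β γ).transitionKernel N T T s.toNNReal z)) → (∫ y, ((y.2 ⟨0, Nat.zero_lt_of_lt hN⟩) ^ 2 / 2 + (pinnedChain ω₂ lam β γ).U (y.1 ⟨0, Nat.zero_lt_of_lt hN⟩) + (pinnedChain ω₂ lam β γ).V (y.1 ⟨1, hN⟩ - y.1 ⟨0, Nat.zero_lt_of_lt hN⟩) / 2) * ((pinnedChain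 ω₂ lam β γ).bondCurrent N ⟨0, Nat.zero_lt_of_lt hN⟩ y - γ * (T - (y.2 ⟨0, Nat.zero_lt_of_lt hN⟩) ^ 2)) ∂((pinnedChain ω₂ lam β γ).gibbsMeasure N T) ≤ γ * T ^ 2) → ∀ t : ℝ, 0 ≤ t → 2 * (∫ s in (0 : ℝ)..t, (t - s) * ∫ z, (pinnedChain ω₂ lam β γ).bondCurrent N ⟨0, Nat.zero_lt_of_lt hN⟩ z * (∫ y, (pinnedChain ω₂ lam β γ).bondCurrent N ⟨0, Nat.zero_lt_of_lt hN⟩ y ∂((pinnedChain ω₂ lam β γ).transitionKernel N T T s.toNNReal z)) ∂((pinnedChain ω₂ lam β γ).gibbsMeasure N T)) ≤ 4 * γ * T ^ 2 * (∫ s in (0 : ℝ)..t, (1 - γ / T ^ 2 * ∫ u in (0 : ℝ)..s, ∫ z, ((z.2 ⟨0, Nat.zero_lt_of_lt hN⟩) ^ 2 - T) * (∫ y, ((y.2 ⟨0, Nat.zero_lt_of_lt hN⟩) ^ 2 - T) ∂((pinnedChain ω₂ lam β γ).transitionKernel N T T u.toNNReal z)) ∂((pinnedChain ω₂ lam β γ).gibbsMeasure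 N T))) + 8 * ∫ z, ((z.2 ⟨0, Nat.zero_lt_of_lt hN⟩) ^ 2 / 2 + (pinnedChain ω₂ lam β γ).U (z.1 ⟨0, Nat.zero_lt_of_lt hN⟩) + (pinnedChain ω₂ lam β γ).V (z.1 ⟨1, hN⟩ - z.1 ⟨0, Nat.zero_lt_of_lt hN⟩) / 2) ^ 2 ∂((pinnedChain ω₂ lam β γ).gibbsMeasure N T) := by
  intro ω₂ lam β γ hω hl hβ hγ T hT N hN hdb hdyn hstat t ht
  exact bathBondReduction_conditional ω₂ lam β γ hω hl hβ hγ T hT N hN hdb hdyn hstat t ht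

end Summit.AtomisticToContinuum.FouriersLaw.Theorems.SubdiffusiveBondHeat
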